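import Mathlib
import HarnessLib

/-!
# [LSW04] Prop. 4.3 (the key estimate): the explicit harmonic function and the `κ = 8` computation

G. F. Lawler, O. Schramm, W. Werner, *Conformal invariance of planar loop-erased random walks and
uniform spanning trees*, Ann. Probab. **32** (2004) 939–995 (**[LSW04]**; arXiv:math/0112234,
where Prop. 4.3 = Prop. 22), §4.2, proof of **Prop. 4.3 (The key estimate)** — the statement
that along the UST Peano exploration `E[W_m - W_k | D_k] = O(δ³)` and
`E[(W_m - W_k)² | D_k] = 8 E[t_m - t_k | D_k] + O(δ³)`, which is where the value `κ = 8` of the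
scaling limit comes from. The printed proof estimates both sides of `P[A] = E[P[A | D_m]]` by the
Dirichlet–Neumann approximation (Prop. 4.2) and Wilson's algorithm, obtaining
`P[A] = h(φ(v₀)/U) + O(δ³)` and `P[A | D_m] = h((V_m - W_m)/(U_m - W_m)) + O(δ³)` with the explicit
harmonic function

> "`h(z) := (1/π) cot⁻¹((1 - |z|)/(2 Im √z))` … we take the value of `cot⁻¹` between `0` and `π`.
> Note that `h` is harmonic in `ℍ`, is equal to `0` on `(0, 1)`, is equal to `1` on `(1, ∞)`, and
> `∂_y h = 0` on `(-∞, 0)`",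

then sets "`f(U, V, W) := h((V - W)/(U - W))`", uses the Loewner expansions (4.11)
"`V_m = V₀ + 2t_m/V₀ + O(δ³)`, `U_m = U₀ + 2t_m/U₀ + O(δ³)`" and

> "We Taylor-expand … to second order in `W_m` and to first order in `V_m - V₀` and `U_m - U₀`. …
> If we plug in `V₀ = i + O(δ³)` and `U₀ = 1 + O(δ³)` … then after some tedious but
> straightforward computations the above equality simplifies to
> `E[W_m²] + 2 E[W_m] - 8 E[t_m] = O(δ³)`, while `V₀ = 2i + O(δ³)` and `U₀ = 1 + O(δ³)` give
> `3 E[W_m²] + 8 E[W_m] - 24 E[t_m] = O(δ³)`. Combining these two relations together implies (4.7)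
> and (4.8)."

This file (theorems and definitions only, no named facts) supplies that analytic, deterministic
part of the proof — everything in it which is not about the uniform spanning tree:

* `KeyEstimate.keyH` — LSW's `h`, DEFINED by the printed formula (`cot⁻¹ x = π/2 - arctan x`);
  `KeyEstimate.keyG` — the holomorphic `G(z) = -(1/π) Log((√z - 1)/(√z + 1))` with
  **`h = 1 + Im G` on `ℍ`** (`keyH_eq`; `√` the principal branch `csqrt`); hence `h` is harmonic
  on `ℍ` (`harmonicOnNhd_keyH`), `h → 0` at points of `(0, 1)` and `h → 1` at points of `(1, ∞)`
  (`tendsto_keyH_zero`, `tendsto_keyH_one`), and the normal derivative `∂_y h = Re G'` has the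
  purely imaginary boundary expression `G'(x) = 1/(π √x (1 - x))`, `√x = i√|x|`, on `(-∞, 0)`
  (`keyG₁_re_of_neg`);
* the derivatives `G' = 1/(π √z (1 - z))` (`keyG₁`, `hasDerivAt_keyG`),
  `G'' = G'(-1/(2z) + 1/(1 - z))` (`keyG₂`, `hasDerivAt_keyG₁`) and their values
  `G'(i) = 1/(π√2)`, `G''(i) = (1/2 + i)/(π√2)`, `G'(2i) = (3 + i)/(10π)`,
  `G''(2i) = (-1 + 43i)/(200π)` (`keyG₁_I`, `keyG₂_I`, `keyG₁_two_mul_I`, `keyG₂_two_mul_I`);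
* a second-order Taylor expansion with cubic remainder for holomorphic functions
  (`norm_sub_taylor_two_le`, three mean value inequalities; `keyG_taylor`);
* the algebra of the Möbius argument `z = (V - W)/(U - W)` about `(1, z₀, 0)`: with `U = 1 + u`,
  `V = z₀ + v`, `|W| ≤ 2δ`, `|u|, |v| ≤ 9δ²`,
  `z - z₀ = v - z₀ u + (z₀ - 1)(W + W²) + O(δ³)` and `(z - z₀)² = (z₀ - 1)² W² + O(δ³)`
  (`zpt`, `Lpt`, `norm_zpt_sub_sub_Lpt_le`, `norm_zpt_sub_sq_sub_le`);
* **the two computations** (`keyF_taylor_I`, `keyF_taylor_two_mul_I`): for every `K` there are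
  `δ₀ > 0` and `C` such that for `0 < δ ≤ δ₀`, whenever `|U₀ - 1| ≤ Kδ³`, `|V₀ - i| ≤ Kδ³`
  (resp. `|V₀ - 2i| ≤ Kδ³`), `|W| ≤ 2δ`, `0 ≤ t ≤ 2δ²`, `|V - V₀ - 2t/V₀| ≤ Kδ³`,
  `|U - U₀ - 2t/U₀| ≤ Kδ³`,
  `|f(U, V, W) - f(U₀, V₀, 0) - (W² + 2W - 8t)/(2√2 π)| ≤ C δ³`
  (resp. `… - (3W² + 8W - 24t)/(16π)| ≤ C δ³`) — the pointwise form of LSW's two displayed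
  relations (taking conditional expectations, with `W = W_m`, `t = t_m`, is the consumer's step);
* `key_relations` — "combining these two relations": `|A + 2B - 8C| ≤ ε`, `|3A + 8B - 24C| ≤ ε`
  give `|B| ≤ 2ε`, `|A - 8C| ≤ 5ε`;
* `prop43_of_estimates` — **the conclusion of Prop. 4.3 for `k = 0`** (`|E[W_m]| ≤ Cδ³`,
  `|E[W_m²] - 8E[t_m]| ≤ Cδ³`) on any probability space, from the printed intermediate estimates
  taken as hypotheses: (4.9) `P[A] = f(U₀, V₀, 0) + O(δ³)`, (4.10)+(4.12)
  `P[A | D_m] = f(U_m, V_m, W_m) + O(δ³)` with `E[P[A | D_m]] = P[A]`, (4.11) the Loewner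
  expansions, at both vertices `v₀` (`φ(v₀) = i + O(δ³)`) and `v₀'` (`φ(v₀') = 2i + O(δ³)`).

The coefficients were checked by hand before formalisation: at `(1, i, 0)`,
`(½ f_WW, f_W, f_V[2/V₀] + 2 f_U/U₀) = (1/(π√2)) (½, 1, -4)`, and at `(1, 2i, 0)` they are
`(3/(16π), 1/(2π), -3/(2π))`, matching the printed relations. What remains of the proof of
Prop. 4.3 outside this file is the UST input producing those hypotheses: Lemma 4.1 (Markov
property) and Prop. 4.2 (Dirichlet–Neumann approximation, §5) with Wilson's algorithm for (4.9),
(4.12), and the Loewner expansions (4.11) (cf. the tree's `Loewner.FarRegime.norm_g_sub_expansion_le`,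
`LoewnerFarField.lean`, with `K = 2δ`, `t ≤ 2δ²`).

## References

* [LSW04] §4.2, Prop. 4.3 and its proof (arXiv:math/0112234, Prop. 22, pp. 22–23)
  [LawlerSchrammWerner2004].
-/

noncomputable section

open Set Filter Metric Complex MeasureTheory
open scoped Topology Real

namespace Literature.Probability.RandomPlanarGeometry

namespace USTPeano

namespace KeyEstimate

/-- The principal square root `√z = z ^ (1/2)`. [folklore] -/
def csqrt (z : ℂ) : ℂ := z ^ (2⁻¹ : ℂ)

/-- `(√z)² = z` for the principal branch. [folklore] -/
theorem csqrt_sq (z : ℂ) : csqrt z ^ 2 = z :=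
  Complex.cpow_ofNat_inv_pow z 2

/-- `√z = exp(½ Log z)` for `z ≠ 0`. [folklore] -/
theorem csqrt_eq_exp {z : ℂ} (hz : z ≠ 0) : csqrt z = exp (log z * 2⁻¹) := by
  rw [csqrt, cpow_def_of_ne_zero hz]

/-- Points of `ℍ` are nonzero. [folklore] -/
theorem ne_zero_of_im_pos {z : ℂ} (hz : 0 < z.im) : z ≠ 0 := fun h ↦ by
  simp [h] at hz

/-- `arg z > 0` on `ℍ`. [folklore] -/
private theorem arg_pos_of_im_pos {z : ℂ} (hz : 0 < z.im) : 0 < arg z := by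
  rcases (arg_nonneg_iff.2 hz.le).eq_or_lt with h | h
  · exact absurd (arg_eq_zero_iff.1 h.symm).2 hz.ne'
  · exact h

/-- `arg z < π` on `ℍ`. [folklore] -/
private theorem arg_lt_pi_of_im_pos {z : ℂ} (hz : 0 < z.im) : arg z < π := by
  rcases (arg_le_pi z).eq_or_lt with h | h
  · exact absurd ((arg_eq_pi_iff.1 h).2) hz.ne'
  · exact h

/-- `2⁻¹ : ℂ` is real. [folklore] -/
theorem inv_two_eq_ofReal : (2⁻¹ : ℂ) = ((2⁻¹ : ℝ) : ℂ) := by norm_num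

/-- `Im(½ Log z) = arg z / 2`. [folklore] -/
theorem log_mul_inv_two_im (z : ℂ) : (log z * 2⁻¹).im = arg z / 2 := by
  rw [inv_two_eq_ofReal, mul_comm, im_ofReal_mul, log_im]
  ring

/-- `Re(½ Log z) = log |z| / 2`. [folklore] -/
theorem log_mul_inv_two_re (z : ℂ) : (log z * 2⁻¹).re = Real.log ‖z‖ / 2 := by
  rw [inv_two_eq_ofReal, mul_comm, re_ofReal_mul, log_re]
  ring

/-- `Im √z > 0` on the upper half-plane. [folklore] -/
theorem csqrt_im_pos {z : ℂ} (hz : 0 < z.im) : 0 < (csqrt z).im := by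
  rw [csqrt_eq_exp (ne_zero_of_im_pos hz), exp_im, log_mul_inv_two_im]
  refine mul_pos (Real.exp_pos _) (Real.sin_pos_of_pos_of_lt_pi ?_ ?_)
  · exact div_pos (arg_pos_of_im_pos hz) two_pos
  · have := arg_lt_pi_of_im_pos hz
    linarith [Real.pi_pos]

/-- `Re √z > 0` on the upper half-plane. [folklore] -/
theorem csqrt_re_pos {z : ℂ} (hz : 0 < z.im) : 0 < (csqrt z).re := by
  rw [csqrt_eq_exp (ne_zero_of_im_pos hz), exp_re, log_mul_inv_two_im]
  refine mul_pos (Real.exp_pos _) (Real.cos_pos_of_mem_Ioo ⟨?_, ?_⟩)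
  · have := arg_pos_of_im_pos hz
    linarith [Real.pi_pos]
  · have := arg_lt_pi_of_im_pos hz
    linarith [Real.pi_pos]

/-- `√z ≠ 0` on `ℍ`. [folklore] -/
theorem csqrt_ne_zero {z : ℂ} (hz : 0 < z.im) : csqrt z ≠ 0 := fun h ↦ by
  have := csqrt_im_pos hz
  rw [h, zero_im] at this
  exact lt_irrefl _ this

/-- `√z + 1 ≠ 0` on `ℍ`. [folklore] -/
theorem csqrt_add_one_ne_zero {z : ℂ} (hz : 0 < z.im) : csqrt z + 1 ≠ 0 := fun h ↦ by
  have := csqrt_im_pos hz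
  have h' : (csqrt z + 1).im = 0 := by rw [h, zero_im]
  rw [add_im, one_im, add_zero] at h'
  rw [h'] at this
  exact lt_irrefl _ this

/-- `√z - 1 ≠ 0` on `ℍ`. [folklore] -/
theorem csqrt_sub_one_ne_zero {z : ℂ} (hz : 0 < z.im) : csqrt z - 1 ≠ 0 := fun h ↦ by
  have := csqrt_im_pos hz
  have h' : (csqrt z - 1).im = 0 := by rw [h, zero_im]
  rw [sub_im, one_im, sub_zero] at h'
  rw [h'] at this
  exact lt_irrefl _ this

/-- `1 - z ≠ 0` on `ℍ`. [folklore] -/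
theorem one_sub_ne_zero {z : ℂ} (hz : 0 < z.im) : 1 - z ≠ 0 := fun h ↦ by
  have h' : (1 - z).im = 0 := by rw [h, zero_im]
  rw [sub_im, one_im, zero_sub, neg_eq_zero] at h'
  exact hz.ne' h'

/-- LSW's Möbius image `q(z) = (√z - 1)/(√z + 1)`. [cite: LawlerSchrammWerner2004, Prop. 4.3 (proof)] -/
def keyQ (z : ℂ) : ℂ := (csqrt z - 1) / (csqrt z + 1)

/-- `Im q(z) = 2 Im √z / |√z + 1|²`. [folklore] -/
theorem keyQ_im (z : ℂ) :
    (keyQ z).im = 2 * (csqrt z).im / normSq (csqrt z + 1) := by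
  rw [keyQ, div_im]
  simp only [sub_im, one_im, sub_zero, add_re, one_re, sub_re, add_im, add_zero]
  ring

/-- `Im q(z) > 0` on `ℍ`: the Möbius map `s ↦ (s - 1)/(s + 1)` preserves `ℍ`. [folklore] -/
theorem keyQ_im_pos {z : ℂ} (hz : 0 < z.im) : 0 < (keyQ z).im := by
  rw [keyQ_im]
  exact div_pos (mul_pos two_pos (csqrt_im_pos hz)) (normSq_pos.2 (csqrt_add_one_ne_zero hz))

/-- `q(z)` avoids the branch cut of `Log` for `z ∈ ℍ`. [folklore] -/
theorem keyQ_mem_slitPlane {z : ℂ} (hz : 0 < z.im) : keyQ z ∈ slitPlane :=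
  mem_slitPlane_iff.2 (Or.inr (keyQ_im_pos hz).ne')

/-- LSW's analytic function `G(z) = -(1/π) Log((√z - 1)/(√z + 1))`; `h = 1 + Im G`. [cite: LawlerSchrammWerner2004, Prop. 4.3 (proof)] -/
def keyG (z : ℂ) : ℂ := -(π : ℂ)⁻¹ * log (keyQ z)

/-- `G'(z) = 1/(π √z (1 - z))`. [cite: LawlerSchrammWerner2004, Prop. 4.3 (proof)] -/
def keyG₁ (z : ℂ) : ℂ := (π : ℂ)⁻¹ / (csqrt z * (1 - z))

/-- `G''(z) = G'(z) (-1/(2z) + 1/(1 - z))`. [cite: LawlerSchrammWerner2004, Prop. 4.3 (proof)] -/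
def keyG₂ (z : ℂ) : ℂ := keyG₁ z * (-(2 * z)⁻¹ + (1 - z)⁻¹)

/-! Algebraic identities in `s = √z` (with `z` replaced by `s ^ 2`). -/

/-- Algebra: `½ · s/s² = 1/(2s)`. [folklore] -/
theorem alg_csqrt_deriv (s : ℂ) (hs0 : s ≠ 0) :
    (2⁻¹ : ℂ) * (s / s ^ 2) = (2 * s)⁻¹ := by
  field_simp

/-- Algebra: `q'(z) = 1/(√z (√z + 1)²)` in terms of `s = √z`. [folklore] -/
theorem alg_keyQ_deriv (s : ℂ) (hs0 : s ≠ 0) (h1 : s + 1 ≠ 0) :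
    ((2 * s)⁻¹ * (s + 1) - (s - 1) * (2 * s)⁻¹) / (s + 1) ^ 2 = (s * (s + 1) ^ 2)⁻¹ := by
  field_simp
  ring

/-- Algebra: `-(1/π) q'/q = 1/(π √z (1 - z))` in terms of `s = √z`, `z = s²`. [folklore] -/
theorem alg_keyG_deriv (s p : ℂ) (hs0 : s ≠ 0) (h1 : s + 1 ≠ 0) (h2 : s - 1 ≠ 0) (hp : p ≠ 0)
    (h3 : 1 - s ^ 2 ≠ 0) :
    -p⁻¹ * ((s * (s + 1) ^ 2)⁻¹ / ((s - 1) / (s + 1))) = p⁻¹ / (s * (1 - s ^ 2)) := by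
  have h4 : (s - 1) / (s + 1) ≠ 0 := div_ne_zero h2 h1
  field_simp
  ring

/-- Algebra: the derivative of `1/(π s (1 - s²))` in terms of `s = √z`. [folklore] -/
theorem alg_keyG₁_deriv (s p : ℂ) (hs0 : s ≠ 0) (hp : p ≠ 0) (h3 : 1 - s ^ 2 ≠ 0) :
    p⁻¹ * (-((2 * s)⁻¹ * (1 - s ^ 2) + s * -1) / (s * (1 - s ^ 2)) ^ 2) =
      p⁻¹ / (s * (1 - s ^ 2)) * (-(2 * s ^ 2)⁻¹ + (1 - s ^ 2)⁻¹) := by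
  field_simp
  ring

/-- `(√z)' = 1/(2 √z)` on `ℍ`. [folklore] -/
theorem hasDerivAt_csqrt {z : ℂ} (hz : 0 < z.im) : HasDerivAt csqrt (2 * csqrt z)⁻¹ z := by
  have hsl : z ∈ slitPlane := mem_slitPlane_iff.2 (Or.inr hz.ne')
  have h := (Complex.hasStrictDerivAt_cpow_const (c := (2⁻¹ : ℂ)) hsl).hasDerivAt
  have hz0 : z ≠ 0 := ne_zero_of_im_pos hz
  have heq : (2⁻¹ : ℂ) * z ^ ((2⁻¹ : ℂ) - 1) = (2 * csqrt z)⁻¹ := by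
    rw [cpow_sub _ _ hz0, cpow_one, show z ^ (2⁻¹ : ℂ) = csqrt z from rfl]
    have h1 := alg_csqrt_deriv (csqrt z) (csqrt_ne_zero hz)
    rwa [csqrt_sq] at h1
  rw [heq] at h
  exact h

/-- `q'(z) = 1/(√z (√z + 1)²)` on `ℍ`. [folklore] -/
theorem hasDerivAt_keyQ {z : ℂ} (hz : 0 < z.im) :
    HasDerivAt keyQ ((csqrt z * (csqrt z + 1) ^ 2)⁻¹) z := by
  have hs := hasDerivAt_csqrt hz
  have h := (hs.sub_const 1).div (hs.add_const 1) (csqrt_add_one_ne_zero hz)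
  rw [alg_keyQ_deriv (csqrt z) (csqrt_ne_zero hz) (csqrt_add_one_ne_zero hz)] at h
  exact h

/-- `1 - (√z)² ≠ 0` on `ℍ`. [folklore] -/
theorem one_sub_csqrt_sq_ne_zero {z : ℂ} (hz : 0 < z.im) : 1 - csqrt z ^ 2 ≠ 0 := by
  rw [csqrt_sq]
  exact one_sub_ne_zero hz

/-- `π ≠ 0` in `ℂ`. [folklore] -/
theorem pi_ne_zero' : (π : ℂ) ≠ 0 := ofReal_ne_zero.2 Real.pi_ne_zero

/-- **`G' = 1/(π √z (1 - z))` on `ℍ`.** [cite: LawlerSchrammWerner2004, Prop. 4.3 (proof)] -/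
theorem hasDerivAt_keyG {z : ℂ} (hz : 0 < z.im) : HasDerivAt keyG (keyG₁ z) z := by
  have hq := (hasDerivAt_keyQ hz).clog (keyQ_mem_slitPlane hz)
  have h := hq.const_mul (-(π : ℂ)⁻¹)
  have key := alg_keyG_deriv (csqrt z) π (csqrt_ne_zero hz) (csqrt_add_one_ne_zero hz)
    (csqrt_sub_one_ne_zero hz) pi_ne_zero' (one_sub_csqrt_sq_ne_zero hz)
  rw [csqrt_sq, show (csqrt z - 1) / (csqrt z + 1) = keyQ z from rfl] at key
  rw [key] at h
  exact h

/-- **`G'' = G' (-1/(2z) + 1/(1 - z))` on `ℍ`.** [cite: LawlerSchrammWerner2004, Prop. 4.3 (proof)] -/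
theorem hasDerivAt_keyG₁ {z : ℂ} (hz : 0 < z.im) : HasDerivAt keyG₁ (keyG₂ z) z := by
  have hs := hasDerivAt_csqrt hz
  have hs0 : csqrt z ≠ 0 := csqrt_ne_zero hz
  have h3 : 1 - z ≠ 0 := one_sub_ne_zero hz
  have hD : HasDerivAt (fun w ↦ csqrt w * (1 - w)) ((2 * csqrt z)⁻¹ * (1 - z) + csqrt z * (-1)) z :=
    hs.mul ((hasDerivAt_id z).const_sub 1 |>.congr_deriv (by simp))
  have hD0 : csqrt z * (1 - z) ≠ 0 := mul_ne_zero hs0 h3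
  have h := (hD.inv hD0).const_mul ((π : ℂ)⁻¹)
  have key := alg_keyG₁_deriv (csqrt z) π hs0 pi_ne_zero' (one_sub_csqrt_sq_ne_zero hz)
  rw [csqrt_sq] at key
  rw [key] at h
  refine h.congr_of_eventuallyEq (Eventually.of_forall fun w ↦ ?_)
  simp [keyG₁, div_eq_mul_inv]

/-! ### Values at `i` and `2i` -/

/-- `e^{iπ/4} = (1 + i)/√2`. [folklore] -/
theorem cexp_pi_div_four_mul_I :
    exp (((π / 4 : ℝ) : ℂ) * I) = ((Real.sqrt 2 / 2 : ℝ) : ℂ) * (1 + I) := by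
  rw [exp_mul_I, ← ofReal_cos, ← ofReal_sin, Real.cos_pi_div_four, Real.sin_pi_div_four]
  ring

/-- `√i = e^{iπ/4} = (1 + i)/√2`. [folklore] -/
theorem csqrt_I : csqrt I = ((Real.sqrt 2 / 2 : ℝ) : ℂ) * (1 + I) := by
  rw [csqrt_eq_exp I_ne_zero, log_I, ← cexp_pi_div_four_mul_I]
  congr 1
  push_cast
  ring

/-- `exp(½ log 2) = √2`. [folklore] -/
theorem exp_half_log_two : Real.exp (Real.log 2 / 2) = Real.sqrt 2 := by
  rw [Real.sqrt_eq_rpow, Real.rpow_def_of_pos two_pos]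
  congr 1
  ring

/-- `√(2i) = 1 + i`. [folklore] -/
theorem csqrt_two_mul_I : csqrt (2 * I) = 1 + I := by
  have h2I : (2 : ℂ) * I ≠ 0 := mul_ne_zero two_ne_zero I_ne_zero
  rw [csqrt_eq_exp h2I, show (2 : ℂ) * I = ((2 : ℝ) : ℂ) * I by norm_num,
    log_ofReal_mul two_pos I_ne_zero, log_I]
  have hexp : (((Real.log 2 : ℝ) : ℂ) + (π : ℂ) / 2 * I) * 2⁻¹ =
      ((Real.log 2 / 2 : ℝ) : ℂ) + ((π / 4 : ℝ) : ℂ) * I := by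
    push_cast
    ring
  rw [hexp, exp_add, cexp_pi_div_four_mul_I, ← ofReal_exp, exp_half_log_two]
  have hsq : ((Real.sqrt 2 : ℝ) : ℂ) * ((Real.sqrt 2 / 2 : ℝ) : ℂ) = 1 := by
    rw [← ofReal_mul, show Real.sqrt 2 * (Real.sqrt 2 / 2) = Real.sqrt 2 * Real.sqrt 2 / 2 by ring,
      Real.mul_self_sqrt zero_le_two]
    norm_num
  rw [← mul_assoc, hsq, one_mul]

/-- `G'(i) = 1/(π √2)` (real). [cite: LawlerSchrammWerner2004, Prop. 4.3 (proof)] -/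
theorem keyG₁_I : keyG₁ I = (((Real.sqrt 2 * π)⁻¹ : ℝ) : ℂ) := by
  rw [keyG₁, csqrt_I]
  have h2 : (1 + I) * (1 - I) = 2 := by
    ring_nf
    rw [I_sq]
    ring
  rw [mul_assoc, h2]
  have hs : ((Real.sqrt 2 / 2 : ℝ) : ℂ) * 2 = (Real.sqrt 2 : ℂ) := by
    push_cast
    ring
  rw [hs]
  have hsq0 : (Real.sqrt 2 : ℂ) ≠ 0 := ofReal_ne_zero.2 (Real.sqrt_ne_zero'.2 two_pos)
  push_cast
  field_simp

/-- `i³ = -i`. [folklore] -/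
theorem I_pow_three : I ^ 3 = -I := by
  rw [pow_succ, I_sq]
  ring

/-- `-1/(2i) + 1/(1 - i) = 1/2 + i`. [folklore] -/
theorem coeff_I : -(2 * I)⁻¹ + (1 - I)⁻¹ = 2⁻¹ + I := by
  have h1 : (1 : ℂ) - I ≠ 0 := one_sub_ne_zero (by simp)
  have h2 : (2 : ℂ) * I ≠ 0 := mul_ne_zero two_ne_zero I_ne_zero
  field_simp
  ring_nf
  rw [I_sq, I_pow_three]
  ring

/-- `G''(i) = (1/2 + i)/(π √2)`. [cite: LawlerSchrammWerner2004, Prop. 4.3 (proof)] -/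
theorem keyG₂_I : keyG₂ I = (((Real.sqrt 2 * π)⁻¹ : ℝ) : ℂ) * (2⁻¹ + I) := by
  rw [keyG₂, keyG₁_I, coeff_I]

/-- `G'(2i) = (3 + i)/(10 π)`. [cite: LawlerSchrammWerner2004, Prop. 4.3 (proof)] -/
theorem keyG₁_two_mul_I : keyG₁ (2 * I) = ((π⁻¹ / 10 : ℝ) : ℂ) * (3 + I) := by
  rw [keyG₁, csqrt_two_mul_I]
  have h3 : (1 + I) * (1 - 2 * I) = 3 - I := by
    ring_nf
    rw [I_sq]
    ring
  rw [h3]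
  have h3' : (3 : ℂ) - I ≠ 0 := fun h ↦ by
    have := congrArg Complex.im h
    simp at this
  have hπ := pi_ne_zero'
  push_cast
  field_simp
  ring_nf
  rw [I_sq]
  ring

/-- `-1/(4i) + 1/(1 - 2i) = 1/5 + 13 i/20`. [folklore] -/
theorem coeff_two_mul_I : -(2 * (2 * I))⁻¹ + (1 - 2 * I)⁻¹ = 5⁻¹ + 13 / 20 * I := by
  have h1 : (1 : ℂ) - 2 * I ≠ 0 := fun h ↦ by
    have := congrArg Complex.im h
    simp at this
  have h2 : (2 : ℂ) * (2 * I) ≠ 0 := mul_ne_zero two_ne_zero (mul_ne_zero two_ne_zero I_ne_zero)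
  field_simp
  ring_nf
  rw [I_sq, I_pow_three]
  ring

/-- `G''(2i) = (3 + i)(1/5 + 13i/20)/(10π) = (-1 + 43 i)/(200 π)`. [cite: LawlerSchrammWerner2004, Prop. 4.3 (proof)] -/
theorem keyG₂_two_mul_I : keyG₂ (2 * I) = ((π⁻¹ / 200 : ℝ) : ℂ) * (-1 + 43 * I) := by
  rw [keyG₂, keyG₁_two_mul_I, coeff_two_mul_I]
  push_cast
  ring_nf
  rw [I_sq]
  ring

/-! ### LSW's harmonic function `h` -/

/-- **LSW's `h`** ([LSW04], proof of Prop. 4.3): `h(z) = (1/π) cot⁻¹((1 - |z|)/(2 Im √z))` with `cot⁻¹ ∈ (0, π)`,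
i.e. `cot⁻¹ x = π/2 - arctan x`. [cite: LawlerSchrammWerner2004, Prop. 4.3 (proof)] -/
def keyH (z : ℂ) : ℝ := π⁻¹ * (π / 2 - Real.arctan ((1 - ‖z‖) / (2 * (csqrt z).im)))

/-- `|√z|² = |z|`. [folklore] -/
theorem normSq_csqrt (z : ℂ) : normSq (csqrt z) = ‖z‖ := by
  rw [normSq_eq_norm_sq, ← norm_pow, csqrt_sq]

/-- `Re q(z) = (|z| - 1)/|√z + 1|²`. [folklore] -/
theorem keyQ_re (z : ℂ) : (keyQ z).re = (‖z‖ - 1) / normSq (csqrt z + 1) := by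
  rw [keyQ, div_re, ← normSq_csqrt]
  simp only [normSq_apply, sub_re, one_re, add_re, sub_im, one_im, sub_zero, add_im, add_zero]
  ring

/-- `Re q / Im q = (|z| - 1)/(2 Im √z)`, the argument of LSW's `cot⁻¹` up to sign. [folklore] -/
theorem keyQ_re_div_im {z : ℂ} (hz : 0 < z.im) :
    (keyQ z).re / (keyQ z).im = (‖z‖ - 1) / (2 * (csqrt z).im) := by
  have hN : normSq (csqrt z + 1) ≠ 0 := (normSq_pos.2 (csqrt_add_one_ne_zero hz)).ne'
  have hs : (csqrt z).im ≠ 0 := (csqrt_im_pos hz).ne'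
  rw [keyQ_re, keyQ_im]
  field_simp

/-- `arg q = π/2 - arctan (re q / im q)` for `im q > 0`. [folklore] -/
private theorem arg_eq_pi_div_two_sub_arctan {q : ℂ} (hq : 0 < q.im) :
    arg q = π / 2 - Real.arctan (q.re / q.im) := by
  have hq0 : q ≠ 0 := ne_zero_of_im_pos hq
  have h1 : 0 < arg q := arg_pos_of_im_pos hq
  have h2 : arg q < π := arg_lt_pi_of_im_pos hq
  have key : Real.arctan (q.re / q.im) = π / 2 - arg q := by
    apply Real.arctan_eq_of_tan_eq
    · rw [Real.tan_pi_div_two_sub, tan_arg, inv_div]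
    · constructor <;> linarith
  linarith

/-- `Im G = -(1/π) arg q`. [folklore] -/
theorem keyG_im (z : ℂ) : (keyG z).im = -π⁻¹ * arg (keyQ z) := by
  rw [keyG, show -(π : ℂ)⁻¹ = ((-π⁻¹ : ℝ) : ℂ) by push_cast; ring, im_ofReal_mul, log_im]

/-- **`h = 1 + Im G` on `ℍ`.** [cite: LawlerSchrammWerner2004, Prop. 4.3 (proof)] -/
theorem keyH_eq {z : ℂ} (hz : 0 < z.im) : keyH z = 1 + (keyG z).im := by
  rw [keyH, keyG_im, arg_eq_pi_div_two_sub_arctan (keyQ_im_pos hz), keyQ_re_div_im hz,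
    show (1 - ‖z‖) / (2 * (csqrt z).im) = -((‖z‖ - 1) / (2 * (csqrt z).im)) by ring,
    Real.arctan_neg]
  have hπ : (π : ℝ) ≠ 0 := Real.pi_ne_zero
  field_simp
  ring

/-! ### Second-order Taylor expansion with cubic remainder for holomorphic functions -/

/-- For `G` holomorphic on a ball: `G(z) = G(z₀) + G'(z₀)(z - z₀) + ½ G''(z₀)(z - z₀)² + O(|z - z₀|³)`
uniformly on the ball of half the radius (three applications of the mean value inequality, the
third derivative being bounded on a compact sub-ball). [folklore] -/
theorem norm_sub_taylor_two_le {G : ℂ → ℂ} {z₀ : ℂ} {ρ : ℝ} (hρ : 0 < ρ)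
    (hG : DifferentiableOn ℂ G (ball z₀ ρ)) :
    ∃ M : ℝ, 0 ≤ M ∧ ∀ z ∈ closedBall z₀ (ρ / 2),
      ‖G z - G z₀ - deriv G z₀ * (z - z₀) - deriv (deriv G) z₀ / 2 * (z - z₀) ^ 2‖ ≤
        M * ‖z - z₀‖ ^ 3 := by
  have hA : AnalyticOnNhd ℂ G (ball z₀ ρ) := hG.analyticOnNhd isOpen_ball
  have hA1 : AnalyticOnNhd ℂ (deriv G) (ball z₀ ρ) := hA.deriv
  have hA2 : AnalyticOnNhd ℂ (deriv (deriv G)) (ball z₀ ρ) := hA1.deriv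
  have hA3 : AnalyticOnNhd ℂ (deriv (deriv (deriv G))) (ball z₀ ρ) := hA2.deriv
  have hsub : closedBall z₀ (ρ / 2) ⊆ ball z₀ ρ := closedBall_subset_ball (by linarith)
  obtain ⟨M₀, hM₀⟩ := (isCompact_closedBall z₀ (ρ / 2)).exists_bound_of_continuousOn
    (hA3.continuousOn.mono hsub)
  set M := max M₀ 0 with hM
  have hM3 : ∀ ζ ∈ closedBall z₀ (ρ / 2), ‖deriv (deriv (deriv G)) ζ‖ ≤ M := fun ζ hζ ↦
    (hM₀ ζ hζ).trans (le_max_left _ _)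
  refine ⟨M, le_max_right _ _, fun z hz ↦ ?_⟩
  set r : ℝ := ‖z - z₀‖ with hr
  have hrle : r ≤ ρ / 2 := by rwa [mem_closedBall, dist_eq_norm] at hz
  set K : Set ℂ := closedBall z₀ r with hK
  have hKsub : K ⊆ closedBall z₀ (ρ / 2) := closedBall_subset_closedBall hrle
  have hKball : K ⊆ ball z₀ ρ := hKsub.trans hsub
  have hKconv : Convex ℝ K := convex_closedBall _ _
  have hz₀K : z₀ ∈ K := mem_closedBall_self (norm_nonneg _)
  have hzK : z ∈ K := by rw [hK, mem_closedBall, dist_eq_norm]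
  have hKr : ∀ ζ ∈ K, ‖ζ - z₀‖ ≤ r := fun ζ hζ ↦ by rwa [hK, mem_closedBall, dist_eq_norm] at hζ
  have hr0 : 0 ≤ r := norm_nonneg _
  -- Step 1: the second derivative is `M`-Lipschitz about `z₀` on `K`
  have h1 : ∀ ζ ∈ K, ‖deriv (deriv G) ζ - deriv (deriv G) z₀‖ ≤ M * ‖ζ - z₀‖ := fun ζ hζ ↦
    hKconv.norm_image_sub_le_of_norm_deriv_le
      (fun x hx ↦ (hA2 x (hKball hx)).differentiableAt)
      (fun x hx ↦ hM3 x (hKsub hx)) hz₀K hζ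
  -- Step 2: the first-order remainder of `G'`
  set R₁ : ℂ → ℂ := fun ζ ↦ deriv G ζ - deriv G z₀ - deriv (deriv G) z₀ * (ζ - z₀) with hR₁
  have hR₁d : ∀ ζ ∈ ball z₀ ρ, HasDerivAt R₁ (deriv (deriv G) ζ - deriv (deriv G) z₀) ζ := by
    intro ζ hζ
    have h := ((hA1 ζ hζ).differentiableAt.hasDerivAt.sub_const (deriv G z₀)).fun_sub
      (((hasDerivAt_id' ζ).sub_const z₀).const_mul (deriv (deriv G) z₀))
    rw [mul_one] at h
    exact h
  have h2 : ∀ ζ ∈ K, ‖R₁ ζ‖ ≤ M * r * ‖ζ - z₀‖ := by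
    intro ζ hζ
    have h := hKconv.norm_image_sub_le_of_norm_deriv_le (f := R₁) (C := M * r)
      (fun x hx ↦ (hR₁d x (hKball hx)).differentiableAt)
      (fun x hx ↦ by
        rw [(hR₁d x (hKball hx)).deriv]
        exact (h1 x hx).trans (mul_le_mul_of_nonneg_left (hKr x hx) (le_max_right _ _)))
      hz₀K hζ
    have hR₁0 : R₁ z₀ = 0 := by simp [hR₁]
    rwa [hR₁0, sub_zero] at h
  -- Step 3: the second-order remainder of `G`
  set R : ℂ → ℂ := fun ζ ↦ G ζ - G z₀ - deriv G z₀ * (ζ - z₀) -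
    deriv (deriv G) z₀ / 2 * (ζ - z₀) ^ 2 with hR
  have hRd : ∀ ζ ∈ ball z₀ ρ, HasDerivAt R (R₁ ζ) ζ := by
    intro ζ hζ
    have hsq : HasDerivAt (fun w : ℂ ↦ (w - z₀) ^ 2) (2 * (ζ - z₀)) ζ := by
      have h := ((hasDerivAt_id' ζ).sub_const z₀).fun_pow 2
      simp only [Nat.cast_ofNat, Nat.add_one_sub_one, pow_one, mul_one] at h
      exact h
    have h := (((hA ζ hζ).differentiableAt.hasDerivAt.sub_const (G z₀)).fun_sub
      (((hasDerivAt_id' ζ).sub_const z₀).const_mul (deriv G z₀))).fun_sub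
      (hsq.const_mul (deriv (deriv G) z₀ / 2))
    have heq : deriv G ζ - deriv G z₀ * 1 - deriv (deriv G) z₀ / 2 * (2 * (ζ - z₀)) = R₁ ζ := by
      simp only [hR₁]
      ring
    rw [heq] at h
    exact h
  have h3 := hKconv.norm_image_sub_le_of_norm_deriv_le (f := R) (C := M * r * r)
    (fun x hx ↦ (hRd x (hKball hx)).differentiableAt)
    (fun x hx ↦ by
      rw [(hRd x (hKball hx)).deriv]
      exact (h2 x hx).trans (mul_le_mul_of_nonneg_left (hKr x hx) (by positivity)))
    hz₀K hzK
  have hR0 : R z₀ = 0 := by simp [hR]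
  rw [hR0, sub_zero] at h3
  calc ‖G z - G z₀ - deriv G z₀ * (z - z₀) - deriv (deriv G) z₀ / 2 * (z - z₀) ^ 2‖
      = ‖R z‖ := rfl
    _ ≤ M * r * r * ‖z - z₀‖ := h3
    _ = M * ‖z - z₀‖ ^ 3 := by rw [hr]; ring

/-- The mean value inequality form used for the base point: `|G z - G z₀| ≤ M₁ |z - z₀|` on a
sub-ball. [folklore] -/
theorem norm_sub_le_of_differentiableOn {G : ℂ → ℂ} {z₀ : ℂ} {ρ : ℝ} (hρ : 0 < ρ)
    (hG : DifferentiableOn ℂ G (ball z₀ ρ)) :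
    ∃ M : ℝ, 0 ≤ M ∧ ∀ z ∈ closedBall z₀ (ρ / 2), ‖G z - G z₀‖ ≤ M * ‖z - z₀‖ := by
  have hA : AnalyticOnNhd ℂ G (ball z₀ ρ) := hG.analyticOnNhd isOpen_ball
  have hA1 : AnalyticOnNhd ℂ (deriv G) (ball z₀ ρ) := hA.deriv
  have hsub : closedBall z₀ (ρ / 2) ⊆ ball z₀ ρ := closedBall_subset_ball (by linarith)
  obtain ⟨M₀, hM₀⟩ := (isCompact_closedBall z₀ (ρ / 2)).exists_bound_of_continuousOn
    (hA1.continuousOn.mono hsub)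
  refine ⟨max M₀ 0, le_max_right _ _, fun z hz ↦ ?_⟩
  exact (convex_closedBall _ _).norm_image_sub_le_of_norm_deriv_le
    (fun x hx ↦ (hA x (hsub hx)).differentiableAt)
    (fun x hx ↦ (hM₀ x hx).trans (le_max_left _ _)) (mem_closedBall_self (by linarith)) hz

/-! ### `G` on the upper half-plane -/

/-- `G` is holomorphic on `ℍ`. [cite: LawlerSchrammWerner2004, Prop. 4.3 (proof)] -/
theorem differentiableOn_keyG : DifferentiableOn ℂ keyG {z : ℂ | 0 < z.im} :=
  fun _ hz ↦ (hasDerivAt_keyG hz).differentiableAt.differentiableWithinAt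

/-- `deriv G = G'` on `ℍ`. [folklore] -/
theorem deriv_keyG {z : ℂ} (hz : 0 < z.im) : deriv keyG z = keyG₁ z := (hasDerivAt_keyG hz).deriv

/-- `deriv (deriv G) = G''` on `ℍ`. [folklore] -/
theorem deriv_deriv_keyG {z : ℂ} (hz : 0 < z.im) : deriv (deriv keyG) z = keyG₂ z := by
  have h : deriv keyG =ᶠ[𝓝 z] keyG₁ := by
    filter_upwards [UpperHalfPlane.isOpen_upperHalfPlaneSet.mem_nhds hz] with w hw
    exact deriv_keyG hw
  rw [h.deriv_eq]
  exact (hasDerivAt_keyG₁ hz).deriv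

/-- The ball of radius `im z₀` about `z₀ ∈ ℍ` lies in `ℍ`. [folklore] -/
theorem ball_subset_im_pos {z₀ : ℂ} {ρ : ℝ} (h : ρ ≤ z₀.im) : ball z₀ ρ ⊆ {z : ℂ | 0 < z.im} := by
  intro z hz
  rw [mem_ball, dist_eq_norm] at hz
  have h1 : |(z - z₀).im| ≤ ‖z - z₀‖ := abs_im_le_norm _
  rw [sub_im] at h1
  have h2 : -(‖z - z₀‖) ≤ z.im - z₀.im := (abs_le.1 h1).1
  show 0 < z.im
  linarith

/-- **Taylor expansion of `G` at a point of `ℍ`**: with `ρ = im z₀`,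
`|G z - G z₀ - G'(z₀)(z - z₀) - ½ G''(z₀)(z - z₀)²| ≤ M |z - z₀|³` for `|z - z₀| ≤ ρ/2`. [cite: LawlerSchrammWerner2004, Prop. 4.3 (proof)] -/
theorem keyG_taylor {z₀ : ℂ} (hz₀ : 0 < z₀.im) :
    ∃ M : ℝ, 0 ≤ M ∧ ∀ z ∈ closedBall z₀ (z₀.im / 2),
      ‖keyG z - keyG z₀ - keyG₁ z₀ * (z - z₀) - keyG₂ z₀ / 2 * (z - z₀) ^ 2‖ ≤ M * ‖z - z₀‖ ^ 3 := by
  obtain ⟨M, hM, h⟩ := norm_sub_taylor_two_le hz₀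
    (differentiableOn_keyG.mono (ball_subset_im_pos le_rfl))
  refine ⟨M, hM, fun z hz ↦ ?_⟩
  have h' := h z hz
  rwa [deriv_keyG hz₀, deriv_deriv_keyG hz₀] at h'

/-- **Lipschitz bound for `G` at a point of `ℍ`.** [folklore] -/
theorem keyG_lipschitz {z₀ : ℂ} (hz₀ : 0 < z₀.im) :
    ∃ M : ℝ, 0 ≤ M ∧ ∀ z ∈ closedBall z₀ (z₀.im / 2), ‖keyG z - keyG z₀‖ ≤ M * ‖z - z₀‖ :=
  norm_sub_le_of_differentiableOn hz₀ (differentiableOn_keyG.mono (ball_subset_im_pos le_rfl))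

/-! ### The Möbius argument `z = (V - W)/(U - W)` near a base point `(U, V, W) = (1, z₀, 0)`

We write `U = 1 + u`, `V = z₀ + v`, `W = w` with `|w| ≤ 2δ`, `|u| ≤ 9δ²`, `|v| ≤ 9δ²`, `δ ≤ 1/40`,
`|z₀| ≤ 2`. Then `z - z₀ = N/D` with `N = v - z₀ u + (z₀ - 1) w`, `D = 1 + u - w ≥ 1/2`, and to third
order `z - z₀ = L + O(δ³)` with `L = v - z₀ u + (z₀ - 1)(w + w²)`, `(z - z₀)² = (z₀ - 1)² w² + O(δ³)`. -/

section Moebius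

variable {z₀ v : ℂ} {u w δ : ℝ}

/-- The perturbed Möbius point. [cite: LawlerSchrammWerner2004, Prop. 4.3 (proof)] -/
def zpt (z₀ v : ℂ) (u w : ℝ) : ℂ := (z₀ + v - w) / (1 + u - w)

/-- The linear-plus-`w²` part `L = v - z₀ u + (z₀ - 1)(w + w²)`. [cite: LawlerSchrammWerner2004, Prop. 4.3 (proof)] -/
def Lpt (z₀ v : ℂ) (u w : ℝ) : ℂ := v - z₀ * u + (z₀ - 1) * (w + w ^ 2)

/-- The denominator `1 + u - w ≥ 1/2`. [folklore] -/
theorem half_le_denom (hδ : δ ≤ 1 / 40) (hu : |u| ≤ 9 * δ ^ 2) (hw : |w| ≤ 2 * δ) :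
    (1 : ℝ) / 2 ≤ 1 + u - w := by
  have hδ0 : 0 ≤ δ := by
    have := (abs_nonneg w).trans hw
    linarith
  have h1 : |u| ≤ 1 / 4 := hu.trans (by nlinarith)
  have h2 : |w| ≤ 1 / 4 := hw.trans (by linarith)
  rw [abs_le] at h1 h2
  linarith [h1.1, h2.2]

/-- The denominator is nonzero. [folklore] -/
theorem denom_ne_zero (hδ : δ ≤ 1 / 40) (hu : |u| ≤ 9 * δ ^ 2) (hw : |w| ≤ 2 * δ) :
    ((1 + u - w : ℝ) : ℂ) ≠ 0 := by
  have := half_le_denom hδ hu hw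
  exact ofReal_ne_zero.2 (by linarith)

/-- `z - z₀ = (v - z₀ u + (z₀ - 1) w)/(1 + u - w)`. [folklore] -/
theorem zpt_sub_eq (z₀ v : ℂ) (u w : ℝ) (hD : ((1 + u - w : ℝ) : ℂ) ≠ 0) :
    zpt z₀ v u w - z₀ = (v - z₀ * u + (z₀ - 1) * w) / ((1 + u - w : ℝ) : ℂ) := by
  rw [zpt, show ((z₀ + v - w) : ℂ) / (1 + u - w) = (z₀ + v - w) / ((1 + u - w : ℝ) : ℂ) by
    push_cast; ring]
  field_simp
  push_cast
  ring

/-- Division by the denominator at most doubles norms. [folklore] -/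
theorem norm_div_denom_le (hδ : δ ≤ 1 / 40) (hu : |u| ≤ 9 * δ ^ 2) (hw : |w| ≤ 2 * δ) (A : ℂ) :
    ‖A / ((1 + u - w : ℝ) : ℂ)‖ ≤ 2 * ‖A‖ := by
  have hD := half_le_denom hδ hu hw
  rw [norm_div, Complex.norm_real, Real.norm_eq_abs, abs_of_pos (by linarith)]
  rw [div_le_iff₀ (by linarith)]
  nlinarith [norm_nonneg A]

/-- The numerator `|v - z₀ u + (z₀ - 1) w| ≤ 7δ`. [folklore] -/
theorem norm_N_le (hz₀ : ‖z₀‖ ≤ 2) (hδ : δ ≤ 1 / 40) (hu : |u| ≤ 9 * δ ^ 2) (hv : ‖v‖ ≤ 9 * δ ^ 2)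
    (hw : |w| ≤ 2 * δ) : ‖v - z₀ * u + (z₀ - 1) * w‖ ≤ 7 * δ := by
  have hδ0 : 0 ≤ δ := by
    have := (abs_nonneg w).trans hw
    linarith
  have h1 : ‖z₀ * (u : ℂ)‖ ≤ 2 * (9 * δ ^ 2) := by
    rw [norm_mul, Complex.norm_real, Real.norm_eq_abs]
    exact mul_le_mul hz₀ hu (abs_nonneg _) (by norm_num)
  have hz1 : ‖z₀ - 1‖ ≤ 3 := (norm_sub_le _ _).trans (by simp; linarith)
  have h2 : ‖(z₀ - 1) * (w : ℂ)‖ ≤ 3 * (2 * δ) := by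
    rw [norm_mul, Complex.norm_real, Real.norm_eq_abs]
    exact mul_le_mul hz1 hw (abs_nonneg _) (by norm_num)
  calc ‖v - z₀ * u + (z₀ - 1) * w‖ ≤ ‖v‖ + ‖z₀ * (u : ℂ)‖ + ‖(z₀ - 1) * (w : ℂ)‖ := by
        exact (norm_add_le _ _).trans (add_le_add (norm_sub_le _ _) le_rfl)
    _ ≤ 9 * δ ^ 2 + 2 * (9 * δ ^ 2) + 3 * (2 * δ) := by linarith
    _ ≤ 7 * δ := by nlinarith

/-- (B1) `|z - z₀| ≤ 14 δ`. [cite: LawlerSchrammWerner2004, Prop. 4.3 (proof)] -/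
theorem norm_zpt_sub_le (hz₀ : ‖z₀‖ ≤ 2) (hδ : δ ≤ 1 / 40) (hu : |u| ≤ 9 * δ ^ 2)
    (hv : ‖v‖ ≤ 9 * δ ^ 2) (hw : |w| ≤ 2 * δ) : ‖zpt z₀ v u w - z₀‖ ≤ 14 * δ := by
  rw [zpt_sub_eq z₀ v u w (denom_ne_zero hδ hu hw)]
  refine (norm_div_denom_le hδ hu hw _).trans ?_
  have := norm_N_le hz₀ hδ hu hv hw
  linarith

/-- The exact third-order remainder of `z - z₀ - L`. [folklore] -/
theorem zpt_sub_sub_Lpt_eq (z₀ v : ℂ) (u w : ℝ) (hD : ((1 + u - w : ℝ) : ℂ) ≠ 0) :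
    zpt z₀ v u w - z₀ - Lpt z₀ v u w =
      ((v - z₀ * u) * w - (v - z₀ * u + (z₀ - 1) * w) * u - (z₀ - 1) * w ^ 2 * u +
        (z₀ - 1) * w ^ 3) / ((1 + u - w : ℝ) : ℂ) := by
  rw [zpt_sub_eq z₀ v u w hD, Lpt]
  have hD' : (1 + (u : ℂ) - w) ≠ 0 := by exact_mod_cast hD
  push_cast
  field_simp
  ring

/-- (B2) `|z - z₀ - L| ≤ 288 δ³`. [cite: LawlerSchrammWerner2004, Prop. 4.3 (proof)] -/
theorem norm_zpt_sub_sub_Lpt_le (hz₀ : ‖z₀‖ ≤ 2) (hδ : δ ≤ 1 / 40) (hu : |u| ≤ 9 * δ ^ 2)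
    (hv : ‖v‖ ≤ 9 * δ ^ 2) (hw : |w| ≤ 2 * δ) :
    ‖zpt z₀ v u w - z₀ - Lpt z₀ v u w‖ ≤ 288 * δ ^ 3 := by
  have hδ0 : 0 ≤ δ := by
    have := (abs_nonneg w).trans hw
    linarith
  rw [zpt_sub_sub_Lpt_eq z₀ v u w (denom_ne_zero hδ hu hw)]
  refine (norm_div_denom_le hδ hu hw _).trans ?_
  have hz1 : ‖z₀ - 1‖ ≤ 3 := (norm_sub_le _ _).trans (by simp; linarith)
  have hN := norm_N_le hz₀ hδ hu hv hw
  have hu' : ‖(u : ℂ)‖ ≤ 9 * δ ^ 2 := by rwa [Complex.norm_real, Real.norm_eq_abs]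
  have hw' : ‖(w : ℂ)‖ ≤ 2 * δ := by rwa [Complex.norm_real, Real.norm_eq_abs]
  have hvu : ‖v - z₀ * u‖ ≤ 27 * δ ^ 2 := by
    calc ‖v - z₀ * u‖ ≤ ‖v‖ + ‖z₀ * (u : ℂ)‖ := norm_sub_le _ _
      _ ≤ 9 * δ ^ 2 + 2 * (9 * δ ^ 2) := by
          rw [norm_mul]
          exact add_le_add hv (mul_le_mul hz₀ hu' (norm_nonneg _) (by norm_num))
      _ = 27 * δ ^ 2 := by ring
  have t1 : ‖(v - z₀ * u) * (w : ℂ)‖ ≤ 27 * δ ^ 2 * (2 * δ) := by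
    rw [norm_mul]; exact mul_le_mul hvu hw' (norm_nonneg _) (by positivity)
  have t2 : ‖(v - z₀ * u + (z₀ - 1) * w) * (u : ℂ)‖ ≤ 7 * δ * (9 * δ ^ 2) := by
    rw [norm_mul]; exact mul_le_mul hN hu' (norm_nonneg _) (by positivity)
  have t3 : ‖(z₀ - 1) * (w : ℂ) ^ 2 * u‖ ≤ 3 * (2 * δ) ^ 2 * (9 * δ ^ 2) := by
    rw [norm_mul, norm_mul, norm_pow]
    exact mul_le_mul (mul_le_mul hz1 (pow_le_pow_left₀ (norm_nonneg _) hw' 2) (by positivity)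
      (by norm_num)) hu' (norm_nonneg _) (by positivity)
  have t4 : ‖(z₀ - 1) * (w : ℂ) ^ 3‖ ≤ 3 * (2 * δ) ^ 3 := by
    rw [norm_mul, norm_pow]
    exact mul_le_mul hz1 (pow_le_pow_left₀ (norm_nonneg _) hw' 3) (by positivity) (by norm_num)
  have hsum : ‖(v - z₀ * u) * w - (v - z₀ * u + (z₀ - 1) * w) * u - (z₀ - 1) * w ^ 2 * u +
      (z₀ - 1) * (w : ℂ) ^ 3‖ ≤ 27 * δ ^ 2 * (2 * δ) + 7 * δ * (9 * δ ^ 2) +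
        3 * (2 * δ) ^ 2 * (9 * δ ^ 2) + 3 * (2 * δ) ^ 3 := by
    refine (norm_add_le _ _).trans (add_le_add ((norm_sub_le _ _).trans
      (add_le_add ((norm_sub_le _ _).trans (add_le_add t1 t2)) t3)) t4)
  have hδ4 : δ ^ 4 ≤ δ ^ 3 / 40 := by nlinarith [pow_nonneg hδ0 3]
  nlinarith

/-- (B3) `|(z - z₀)² - (z₀ - 1)² w²| ≤ 658 δ³`. [cite: LawlerSchrammWerner2004, Prop. 4.3 (proof)] -/
theorem norm_zpt_sub_sq_sub_le (hz₀ : ‖z₀‖ ≤ 2) (hδ : δ ≤ 1 / 40) (hu : |u| ≤ 9 * δ ^ 2)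
    (hv : ‖v‖ ≤ 9 * δ ^ 2) (hw : |w| ≤ 2 * δ) :
    ‖(zpt z₀ v u w - z₀) ^ 2 - (z₀ - 1) ^ 2 * (w : ℂ) ^ 2‖ ≤ 658 * δ ^ 3 := by
  have hδ0 : 0 ≤ δ := by
    have := (abs_nonneg w).trans hw
    linarith
  have hz1 : ‖z₀ - 1‖ ≤ 3 := (norm_sub_le _ _).trans (by simp; linarith)
  have hu' : ‖(u : ℂ)‖ ≤ 9 * δ ^ 2 := by rwa [Complex.norm_real, Real.norm_eq_abs]
  have hw' : ‖(w : ℂ)‖ ≤ 2 * δ := by rwa [Complex.norm_real, Real.norm_eq_abs]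
  set r₁ : ℂ := zpt z₀ v u w - z₀ - (z₀ - 1) * w with hr₁
  have hr₁eq : r₁ = (v - z₀ * u) + (z₀ - 1) * (w : ℂ) ^ 2 + (zpt z₀ v u w - z₀ - Lpt z₀ v u w) := by
    simp only [hr₁, Lpt]; ring
  have hvu : ‖v - z₀ * u‖ ≤ 27 * δ ^ 2 := by
    calc ‖v - z₀ * u‖ ≤ ‖v‖ + ‖z₀ * (u : ℂ)‖ := norm_sub_le _ _
      _ ≤ 9 * δ ^ 2 + 2 * (9 * δ ^ 2) := by
          rw [norm_mul]
          exact add_le_add hv (mul_le_mul hz₀ hu' (norm_nonneg _) (by norm_num))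
      _ = 27 * δ ^ 2 := by ring
  have hw2 : ‖(z₀ - 1) * (w : ℂ) ^ 2‖ ≤ 3 * (2 * δ) ^ 2 := by
    rw [norm_mul, norm_pow]
    exact mul_le_mul hz1 (pow_le_pow_left₀ (norm_nonneg _) hw' 2) (by positivity) (by norm_num)
  have hB2 := norm_zpt_sub_sub_Lpt_le hz₀ hδ hu hv hw
  have hr₁le : ‖r₁‖ ≤ 47 * δ ^ 2 := by
    rw [hr₁eq]
    refine ((norm_add_le _ _).trans (add_le_add ((norm_add_le _ _).trans (add_le_add hvu hw2))
      hB2)).trans ?_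
    nlinarith
  have hid : (zpt z₀ v u w - z₀) ^ 2 - (z₀ - 1) ^ 2 * (w : ℂ) ^ 2 =
      r₁ * (2 * ((z₀ - 1) * w) + r₁) := by
    simp only [hr₁]; ring
  rw [hid, norm_mul]
  have h2 : ‖2 * ((z₀ - 1) * (w : ℂ)) + r₁‖ ≤ 2 * (3 * (2 * δ)) + 47 * δ ^ 2 := by
    refine (norm_add_le _ _).trans (add_le_add ?_ hr₁le)
    rw [norm_mul, norm_mul, Complex.norm_ofNat]
    exact mul_le_mul_of_nonneg_left (mul_le_mul hz1 hw' (norm_nonneg _) (by norm_num)) (by norm_num)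
  calc ‖r₁‖ * ‖2 * ((z₀ - 1) * (w : ℂ)) + r₁‖ ≤ 47 * δ ^ 2 * (2 * (3 * (2 * δ)) + 47 * δ ^ 2) :=
        mul_le_mul hr₁le h2 (norm_nonneg _) (by positivity)
    _ ≤ 658 * δ ^ 3 := by nlinarith [pow_nonneg hδ0 2, pow_nonneg hδ0 3]

end Moebius

/-! ### LSW's `f(U, V, W) = h((V - W)/(U - W))` and the Taylor computation at `(1, i, 0)` -/

/-- **LSW's `f`** ([LSW04], proof of Prop. 4.3: "Write `f(U, V, W) := h((V - W)/(U - W))`"), for real `U, W`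
and complex `V`. [cite: LawlerSchrammWerner2004, Prop. 4.3 (proof)] -/
def keyF (U : ℝ) (V : ℂ) (W : ℝ) : ℝ := keyH ((V - W) / (U - W))

/-- `f(U, V, W) = h(z)` with `z` the perturbed Möbius point at base `z₀`, `v = V - z₀`, `u = U - 1`. [folklore] -/
theorem keyF_eq_keyH_zpt (z₀ : ℂ) (U : ℝ) (V : ℂ) (W : ℝ) :
    keyF U V W = keyH (zpt z₀ (V - z₀) (U - 1) W) := by
  rw [keyF, zpt]
  congr 1
  push_cast
  ring

/-- The imaginary part of the main term at `z₀ = i`: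
`Im(G'(i) L + ½ G''(i) (i - 1)² w²) = (v.im - u + w + w²/2)/(√2 π)`. [cite: LawlerSchrammWerner2004, Prop. 4.3 (proof)] -/
theorem im_main_I (v : ℂ) (u w : ℝ) :
    (keyG₁ I * Lpt I v u w + keyG₂ I / 2 * (I - 1) ^ 2 * (w : ℂ) ^ 2).im =
      (Real.sqrt 2 * π)⁻¹ * (v.im - u + w + w ^ 2 / 2) := by
  rw [keyG₂_I, keyG₁_I, Lpt, div_eq_mul_inv _ (2 : ℂ), inv_two_eq_ofReal]
  simp only [mul_im, mul_re, add_im, add_re, sub_im, sub_re, ofReal_im, ofReal_re, I_im, I_re,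
    one_im, one_re, pow_two]
  ring

/-- **Smallness bookkeeping** for the hypotheses of the key computation: with
`δ ≤ 1/(40 (K + 1))`, the reduced variables `u = U - 1`, `v = V - z₀` satisfy `|u|, |v| ≤ 9δ²`. [cite: LawlerSchrammWerner2004, Prop. 4.3 (proof)] -/
theorem reduced_bounds {K δ U₀ U t : ℝ} {z₀ V₀ V : ℂ} (hK : 0 ≤ K) (hδ : 0 < δ)
    (hδ₀ : δ ≤ 1 / (40 * (K + 1))) (hz₀ : 1 ≤ ‖z₀‖)
    (hU₀ : |U₀ - 1| ≤ K * δ ^ 3) (hV₀ : ‖V₀ - z₀‖ ≤ K * δ ^ 3) (ht : 0 ≤ t) (ht2 : t ≤ 2 * δ ^ 2)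
    (hV : ‖V - V₀ - 2 * t / V₀‖ ≤ K * δ ^ 3) (hU : |U - U₀ - 2 * t / U₀| ≤ K * δ ^ 3) :
    δ ≤ 1 / 40 ∧ K * δ ^ 3 ≤ δ ^ 2 / 40 ∧ 8 * δ ^ 2 ≤ 1 ∧ 1 / 2 ≤ U₀ ∧ 1 / 2 ≤ ‖V₀‖ ∧
      |U - 1| ≤ 9 * δ ^ 2 ∧ ‖V - z₀‖ ≤ 9 * δ ^ 2 ∧ |U₀ - 1| ≤ 9 * δ ^ 2 := by
  have hδ40 : δ ≤ 1 / 40 := hδ₀.trans (by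
    rw [div_le_div_iff₀ (by positivity) (by norm_num)]; nlinarith)
  have hKδ : K * δ ≤ 1 / 40 := by
    calc K * δ ≤ K * (1 / (40 * (K + 1))) := by gcongr
      _ ≤ 1 / 40 := by
          rw [mul_one_div, div_le_div_iff₀ (by positivity) (by norm_num)]
          nlinarith
  have hKδ3 : K * δ ^ 3 ≤ δ ^ 2 / 40 := by nlinarith [pow_nonneg hδ.le 2]
  have hδsq : 8 * δ ^ 2 ≤ 1 := by nlinarith
  have hU₀n : 1 / 2 ≤ U₀ := by
    have := (abs_le.1 (hU₀.trans hKδ3)).1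
    nlinarith
  have hV₀n : 1 / 2 ≤ ‖V₀‖ := by
    have h1 : ‖z₀‖ - ‖V₀‖ ≤ ‖z₀ - V₀‖ := norm_sub_norm_le z₀ V₀
    rw [norm_sub_rev] at h1
    have h2 : ‖V₀ - z₀‖ ≤ δ ^ 2 / 40 := hV₀.trans hKδ3
    nlinarith
  have hu9 : |U - 1| ≤ 9 * δ ^ 2 := by
    have h1 : |2 * t / U₀| ≤ 8 * δ ^ 2 := by
      rw [abs_div, abs_of_nonneg (by linarith), abs_of_pos (by linarith : (0 : ℝ) < U₀),
        div_le_iff₀ (by linarith)]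
      nlinarith
    have h2 : U - 1 = (U - U₀ - 2 * t / U₀) + (U₀ - 1) + 2 * t / U₀ := by ring
    rw [h2]
    refine ((abs_add_le _ _).trans (add_le_add ((abs_add_le _ _).trans (add_le_add hU hU₀))
      h1)).trans ?_
    nlinarith
  have hv9 : ‖V - z₀‖ ≤ 9 * δ ^ 2 := by
    have hV₀0 : V₀ ≠ 0 := fun h ↦ by rw [h, norm_zero] at hV₀n; linarith
    have h1 : ‖2 * t / V₀‖ ≤ 8 * δ ^ 2 := by
      rw [norm_div, show (2 * t : ℂ) = ((2 * t : ℝ) : ℂ) by push_cast; ring, Complex.norm_real,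
        Real.norm_eq_abs, abs_of_nonneg (by linarith), div_le_iff₀ (by linarith)]
      nlinarith
    have h2 : V - z₀ = (V - V₀ - 2 * t / V₀) + (V₀ - z₀) + 2 * t / V₀ := by ring
    rw [h2]
    refine ((norm_add_le _ _).trans (add_le_add ((norm_add_le _ _).trans (add_le_add hV hV₀))
      h1)).trans ?_
    nlinarith
  exact ⟨hδ40, hKδ3, hδsq, hU₀n, hV₀n, hu9, hv9, hU₀.trans (by nlinarith)⟩

/-- The `t`-term of `V`: `|2t/V₀ - 2t/z₀| ≤ K δ³`. [folklore] -/
theorem norm_div_sub_div_le {V₀ z₀ : ℂ} {t K δ : ℝ} (hK : 0 ≤ K) (hδ0 : 0 ≤ δ) (ht : 0 ≤ t)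
    (ht2 : t ≤ 2 * δ ^ 2) (hδ : 8 * δ ^ 2 ≤ 1) (hV₀ : ‖V₀ - z₀‖ ≤ K * δ ^ 3)
    (hV₀n : 1 / 2 ≤ ‖V₀‖) (hz₀ : 1 ≤ ‖z₀‖) : ‖2 * t / V₀ - 2 * t / z₀‖ ≤ K * δ ^ 3 := by
  have hV₀0 : V₀ ≠ 0 := fun h ↦ by rw [h, norm_zero] at hV₀n; linarith
  have hz₀0 : z₀ ≠ 0 := fun h ↦ by rw [h, norm_zero] at hz₀; linarith
  have heq : (2 * t / V₀ - 2 * t / z₀ : ℂ) = ((2 * t : ℝ) : ℂ) * ((z₀ - V₀) / (V₀ * z₀)) := by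
    push_cast
    field_simp
  rw [heq, norm_mul, Complex.norm_real, Real.norm_eq_abs, abs_of_nonneg (by linarith), norm_div,
    norm_mul, norm_sub_rev]
  have h1 : ‖V₀ - z₀‖ / (‖V₀‖ * ‖z₀‖) ≤ 2 * (K * δ ^ 3) := by
    rw [div_le_iff₀ (by positivity)]
    calc ‖V₀ - z₀‖ ≤ K * δ ^ 3 := hV₀
      _ = 2 * (K * δ ^ 3) * (1 / 2 * 1) := by ring
      _ ≤ 2 * (K * δ ^ 3) * (‖V₀‖ * ‖z₀‖) := by gcongr
  calc 2 * t * (‖V₀ - z₀‖ / (‖V₀‖ * ‖z₀‖)) ≤ 2 * (2 * δ ^ 2) * (2 * (K * δ ^ 3)) := by gcongr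
    _ = (8 * δ ^ 2) * (K * δ ^ 3) := by ring
    _ ≤ 1 * (K * δ ^ 3) := by gcongr
    _ = K * δ ^ 3 := one_mul _

/-- The reduced `V`-variable is `2t/z₀` to third order: `|v - 2t/z₀| ≤ 3 K δ³`. [folklore] -/
theorem norm_v_sub_le {V₀ V z₀ : ℂ} {t K δ : ℝ} (hK : 0 ≤ K) (hδ0 : 0 ≤ δ) (ht : 0 ≤ t)
    (ht2 : t ≤ 2 * δ ^ 2) (hδ : 8 * δ ^ 2 ≤ 1) (hV₀ : ‖V₀ - z₀‖ ≤ K * δ ^ 3)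
    (hV₀n : 1 / 2 ≤ ‖V₀‖) (hz₀ : 1 ≤ ‖z₀‖) (hV : ‖V - V₀ - 2 * t / V₀‖ ≤ K * δ ^ 3) :
    ‖V - z₀ - 2 * t / z₀‖ ≤ 3 * (K * δ ^ 3) := by
  have h1 := norm_div_sub_div_le hK hδ0 ht ht2 hδ hV₀ hV₀n hz₀
  have h2 : V - z₀ - 2 * t / z₀ = (V - V₀ - 2 * t / V₀) + (V₀ - z₀) + (2 * t / V₀ - 2 * t / z₀) := by
    ring
  rw [h2]
  refine ((norm_add_le _ _).trans (add_le_add ((norm_add_le _ _).trans (add_le_add hV hV₀))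
    h1)).trans ?_
  linarith

/-- The reduced `U`-variable is `2t` to third order: `|u - 2t| ≤ 3 K δ³`. [folklore] -/
theorem abs_u_sub_le {U₀ U t K δ : ℝ} (hK : 0 ≤ K) (hδ0 : 0 ≤ δ) (ht : 0 ≤ t)
    (ht2 : t ≤ 2 * δ ^ 2) (hδ : 8 * δ ^ 2 ≤ 1) (hU₀ : |U₀ - 1| ≤ K * δ ^ 3) (hU₀n : 1 / 2 ≤ U₀)
    (hU : |U - U₀ - 2 * t / U₀| ≤ K * δ ^ 3) : |U - 1 - 2 * t| ≤ 3 * (K * δ ^ 3) := by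
  have hU₀0 : U₀ ≠ 0 := by intro h; rw [h] at hU₀n; linarith
  have heq : 2 * t / U₀ - 2 * t = 2 * t * ((1 - U₀) / U₀) := by field_simp
  have h1 : |2 * t / U₀ - 2 * t| ≤ K * δ ^ 3 := by
    rw [heq, abs_mul, abs_of_nonneg (by linarith), abs_div, abs_of_pos (by linarith : (0 : ℝ) < U₀),
      abs_sub_comm]
    have h1 : |U₀ - 1| / U₀ ≤ 2 * (K * δ ^ 3) := by
      rw [div_le_iff₀ (by linarith)]
      nlinarith [abs_nonneg (U₀ - 1)]
    calc 2 * t * (|U₀ - 1| / U₀) ≤ 2 * (2 * δ ^ 2) * (2 * (K * δ ^ 3)) := by gcongr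
      _ = (8 * δ ^ 2) * (K * δ ^ 3) := by ring
      _ ≤ 1 * (K * δ ^ 3) := by gcongr
      _ = K * δ ^ 3 := one_mul _
  have h2 : U - 1 - 2 * t = (U - U₀ - 2 * t / U₀) + (U₀ - 1) + (2 * t / U₀ - 2 * t) := by ring
  rw [h2]
  refine ((abs_add_le _ _).trans (add_le_add ((abs_add_le _ _).trans (add_le_add hU hU₀))
    h1)).trans ?_
  linarith

/-- Points close to a point `z₀` with `im z₀ ≥ 1` are in `ℍ`. [folklore] -/
theorem im_pos_of_norm_sub_le {z z₀ : ℂ} {r : ℝ} (hz₀ : 1 ≤ z₀.im) (h : ‖z - z₀‖ ≤ r) (hr : r < 1) :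
    0 < z.im := by
  have h1 : |(z - z₀).im| ≤ ‖z - z₀‖ := abs_im_le_norm _
  rw [sub_im] at h1
  have h2 := (abs_le.1 (h1.trans h)).1
  linarith

/-- **The base point moves by `O(δ³)`**: `|z(U₀, V₀, 0) - z₀| ≤ 4 K δ³`. [cite: LawlerSchrammWerner2004, Prop. 4.3 (proof)] -/
theorem norm_zpt_base_sub_le {z₀ V₀ : ℂ} {U₀ K δ : ℝ} (hz₀ : ‖z₀‖ ≤ 2) (hδ40 : δ ≤ 1 / 40)
    (hδ : 0 ≤ δ) (hU₀ : |U₀ - 1| ≤ K * δ ^ 3) (hU₀9 : |U₀ - 1| ≤ 9 * δ ^ 2)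
    (hV₀ : ‖V₀ - z₀‖ ≤ K * δ ^ 3) :
    ‖zpt z₀ (V₀ - z₀) (U₀ - 1) 0 - z₀‖ ≤ 6 * (K * δ ^ 3) := by
  have h0W : |(0 : ℝ)| ≤ 2 * δ := by rw [abs_zero]; linarith
  rw [zpt_sub_eq z₀ (V₀ - z₀) (U₀ - 1) 0 (denom_ne_zero hδ40 hU₀9 h0W)]
  refine (norm_div_denom_le hδ40 hU₀9 h0W _).trans ?_
  have h1 : ‖V₀ - z₀ - z₀ * ((U₀ - 1 : ℝ) : ℂ) + (z₀ - 1) * ((0 : ℝ) : ℂ)‖ ≤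
      K * δ ^ 3 + 2 * (K * δ ^ 3) := by
    rw [ofReal_zero, mul_zero, add_zero]
    refine (norm_sub_le _ _).trans (add_le_add hV₀ ?_)
    rw [norm_mul, Complex.norm_real, Real.norm_eq_abs]
    exact mul_le_mul hz₀ hU₀ (abs_nonneg _) (by norm_num)
  linarith

/-- **The Taylor pieces**: for a base point `z₀ ∈ ℍ` with `1 ≤ im z₀`, `|z₀| ≤ 2`, and reduced
variables as in `reduced_bounds`,
`G z - G z₀ = (G'(z₀) L + ½ G''(z₀)(z₀ - 1)² w²) + R` with `|R| ≤ C δ³`, and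
`|G z' - G z₀| ≤ C' δ³` for the base point `z'`. [cite: LawlerSchrammWerner2004, Prop. 4.3 (proof)] -/
theorem keyG_pieces {z₀ : ℂ} (hz₀im : 1 ≤ z₀.im) (hz₀ : ‖z₀‖ ≤ 2) (K : ℝ) (hK : 0 ≤ K) :
    ∃ C : ℝ, ∀ (δ : ℝ) (v V₀ : ℂ) (u U₀ w : ℝ), 0 < δ → δ ≤ 1 / 40 → K * δ ^ 3 ≤ δ ^ 2 / 40 →
      |u| ≤ 9 * δ ^ 2 → ‖v‖ ≤ 9 * δ ^ 2 → |w| ≤ 2 * δ → |U₀ - 1| ≤ K * δ ^ 3 →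
      |U₀ - 1| ≤ 9 * δ ^ 2 → ‖V₀ - z₀‖ ≤ K * δ ^ 3 →
      0 < (zpt z₀ v u w).im ∧ 0 < (zpt z₀ (V₀ - z₀) (U₀ - 1) 0).im ∧
      ‖keyG (zpt z₀ v u w) - keyG z₀ -
          (keyG₁ z₀ * Lpt z₀ v u w + keyG₂ z₀ / 2 * (z₀ - 1) ^ 2 * (w : ℂ) ^ 2)‖ ≤ C * δ ^ 3 ∧
      ‖keyG (zpt z₀ (V₀ - z₀) (U₀ - 1) 0) - keyG z₀‖ ≤ C * δ ^ 3 := by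
  have hz₀pos : 0 < z₀.im := by linarith
  obtain ⟨M, hM0, hM⟩ := keyG_taylor hz₀pos
  obtain ⟨M₁, hM₁0, hM₁⟩ := keyG_lipschitz hz₀pos
  refine ⟨M * 14 ^ 3 + ‖keyG₁ z₀‖ * 288 + ‖keyG₂ z₀‖ / 2 * 658 + M₁ * (6 * K), ?_⟩
  intro δ v V₀ u U₀ w hδ hδ40 hKδ3 hu hv hw hU₀ hU₀9 hV₀
  set z : ℂ := zpt z₀ v u w with hz_def
  set z' : ℂ := zpt z₀ (V₀ - z₀) (U₀ - 1) 0 with hz'_def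
  have hz14 : ‖z - z₀‖ ≤ 14 * δ := norm_zpt_sub_le hz₀ hδ40 hu hv hw
  have hzball : z ∈ closedBall z₀ (z₀.im / 2) := by
    rw [mem_closedBall, dist_eq_norm]
    linarith
  have hzim : 0 < z.im := im_pos_of_norm_sub_le hz₀im hz14 (by linarith)
  have hz'le : ‖z' - z₀‖ ≤ 6 * (K * δ ^ 3) := norm_zpt_base_sub_le hz₀ hδ40 hδ.le hU₀ hU₀9 hV₀
  have hz'ball : z' ∈ closedBall z₀ (z₀.im / 2) := by
    rw [mem_closedBall, dist_eq_norm]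
    nlinarith [pow_nonneg hδ.le 2]
  have hz'im : 0 < z'.im := im_pos_of_norm_sub_le hz₀im hz'le (by nlinarith [pow_nonneg hδ.le 2])
  refine ⟨hzim, hz'im, ?_, ?_⟩
  · have hT := hM z hzball
    have hA : ‖keyG₁ z₀ * (z - z₀ - Lpt z₀ v u w)‖ ≤ ‖keyG₁ z₀‖ * (288 * δ ^ 3) := by
      rw [norm_mul]
      exact mul_le_mul_of_nonneg_left (norm_zpt_sub_sub_Lpt_le hz₀ hδ40 hu hv hw) (norm_nonneg _)
    have hB : ‖keyG₂ z₀ / 2 * ((z - z₀) ^ 2 - (z₀ - 1) ^ 2 * (w : ℂ) ^ 2)‖ ≤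
        ‖keyG₂ z₀‖ / 2 * (658 * δ ^ 3) := by
      rw [norm_mul, norm_div, Complex.norm_ofNat]
      exact mul_le_mul_of_nonneg_left (norm_zpt_sub_sq_sub_le hz₀ hδ40 hu hv hw) (by positivity)
    have hid : keyG z - keyG z₀ -
        (keyG₁ z₀ * Lpt z₀ v u w + keyG₂ z₀ / 2 * (z₀ - 1) ^ 2 * (w : ℂ) ^ 2) =
        (keyG z - keyG z₀ - keyG₁ z₀ * (z - z₀) - keyG₂ z₀ / 2 * (z - z₀) ^ 2) +
          keyG₁ z₀ * (z - z₀ - Lpt z₀ v u w) +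
          keyG₂ z₀ / 2 * ((z - z₀) ^ 2 - (z₀ - 1) ^ 2 * (w : ℂ) ^ 2) := by ring
    rw [hid]
    refine ((norm_add_le _ _).trans (add_le_add ((norm_add_le _ _).trans (add_le_add hT hA))
      hB)).trans ?_
    have h3 : M * ‖z - z₀‖ ^ 3 ≤ M * (14 * δ) ^ 3 :=
      mul_le_mul_of_nonneg_left (pow_le_pow_left₀ (norm_nonneg _) hz14 3) hM0
    have h4 : 0 ≤ M₁ * (6 * K) * δ ^ 3 := by positivity
    have h5 : M * (14 * δ) ^ 3 = M * 14 ^ 3 * δ ^ 3 := by ring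
    rw [h5] at h3
    have h6 : (M * 14 ^ 3 + ‖keyG₁ z₀‖ * 288 + ‖keyG₂ z₀‖ / 2 * 658 + M₁ * (6 * K)) * δ ^ 3 =
        M * 14 ^ 3 * δ ^ 3 + ‖keyG₁ z₀‖ * (288 * δ ^ 3) + ‖keyG₂ z₀‖ / 2 * (658 * δ ^ 3) +
          M₁ * (6 * K) * δ ^ 3 := by ring
    rw [h6]
    linarith
  · refine ((hM₁ z' hz'ball).trans (mul_le_mul_of_nonneg_left hz'le hM₁0)).trans ?_
    have h4 : 0 ≤ (M * 14 ^ 3 + ‖keyG₁ z₀‖ * 288 + ‖keyG₂ z₀‖ / 2 * 658) * δ ^ 3 := by positivity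
    have h6 : (M * 14 ^ 3 + ‖keyG₁ z₀‖ * 288 + ‖keyG₂ z₀‖ / 2 * 658 + M₁ * (6 * K)) * δ ^ 3 =
        (M * 14 ^ 3 + ‖keyG₁ z₀‖ * 288 + ‖keyG₂ z₀‖ / 2 * 658) * δ ^ 3 + M₁ * (6 * (K * δ ^ 3)) := by
      ring
    rw [h6]
    linarith

/-- **The key Taylor computation at the base point `(U₀, V₀, W₀) = (1 + O(δ³), i + O(δ³), 0)`**
([LSW04], proof of Prop. 4.3: the expansion of `f(U_m, V_m, W_m) - f(U₀, V₀, 0)` "to second order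
in `W_m` and to first order in `V_m - V₀` and `U_m - U₀`", with `V_m = V₀ + 2t_m/V₀ + O(δ³)`,
`U_m = U₀ + 2t_m/U₀ + O(δ³)`, `|W_m| ≤ 2δ`, `t_m ≤ 2δ²`, which "after some tedious but
straightforward computations … simplifies to `E[W_m²] + 2 E[W_m] - 8 E[t_m] = O(δ³)`"): pointwise,
`f(U, V, W) - f(U₀, V₀, 0) = (W² + 2W - 8t)/(2√2 π) + O(δ³)`. [cite: LawlerSchrammWerner2004, Prop. 4.3 (proof)] -/
theorem keyF_taylor_I (K : ℝ) (hK : 0 ≤ K) : ∃ δ₀ : ℝ, 0 < δ₀ ∧ ∃ C : ℝ, ∀ δ : ℝ, 0 < δ → δ ≤ δ₀ →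
    ∀ (U₀ U W t : ℝ) (V₀ V : ℂ), |U₀ - 1| ≤ K * δ ^ 3 → ‖V₀ - I‖ ≤ K * δ ^ 3 → |W| ≤ 2 * δ →
      0 ≤ t → t ≤ 2 * δ ^ 2 → ‖V - V₀ - 2 * t / V₀‖ ≤ K * δ ^ 3 →
      |U - U₀ - 2 * t / U₀| ≤ K * δ ^ 3 →
      |keyF U V W - keyF U₀ V₀ 0 - (W ^ 2 + 2 * W - 8 * t) / (2 * Real.sqrt 2 * π)| ≤
        C * δ ^ 3 := by
  obtain ⟨C, hC⟩ := keyG_pieces (z₀ := I) (by simp) (by simp) K hK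
  set a : ℝ := (Real.sqrt 2 * π)⁻¹ with ha
  have ha0 : 0 ≤ a := by positivity
  refine ⟨1 / (40 * (K + 1)), by positivity, a * (6 * K) + C + C, ?_⟩
  intro δ hδ hδ₀ U₀ U W t V₀ V hU₀ hV₀ hW ht ht2 hV hU
  obtain ⟨hδ40, hKδ3, hδsq, hU₀n, hV₀n, hu9, hv9, hU₀9⟩ :=
    reduced_bounds hK hδ hδ₀ (by simp) hU₀ hV₀ ht ht2 hV hU
  obtain ⟨hzim, hz'im, hR, hbase⟩ :=
    hC δ (V - I) V₀ (U - 1) U₀ W hδ hδ40 hKδ3 hu9 hv9 hW hU₀ hU₀9 hV₀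
  -- the `t`-terms
  have hEv : |(V - I).im + 2 * t| ≤ 3 * (K * δ ^ 3) := by
    have h := norm_v_sub_le hK hδ.le ht ht2 hδsq hV₀ hV₀n (by simp) hV
    have h2 : (V - I).im + 2 * t = (V - I - 2 * t / I).im := by
      simp [div_I, sub_im, mul_im]
    rw [h2]
    exact (abs_im_le_norm _).trans h
  have hEu : |U - 1 - 2 * t| ≤ 3 * (K * δ ^ 3) := abs_u_sub_le hK hδ.le ht ht2 hδsq hU₀ hU₀n hU
  -- `h = 1 + Im G`, and the split of `G z - G z'`
  rw [keyF_eq_keyH_zpt I U V W, keyF_eq_keyH_zpt I U₀ V₀ 0, keyH_eq hzim, keyH_eq hz'im]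
  obtain ⟨R, hRdef⟩ : ∃ R : ℂ, R = keyG (zpt I (V - I) (U - 1) W) - keyG I -
      (keyG₁ I * Lpt I (V - I) (U - 1) W + keyG₂ I / 2 * (I - 1) ^ 2 * (W : ℂ) ^ 2) := ⟨_, rfl⟩
  obtain ⟨B, hBdef⟩ : ∃ B : ℂ, B = keyG (zpt I (V₀ - I) (U₀ - 1) 0) - keyG I := ⟨_, rfl⟩
  rw [← hRdef] at hR
  rw [← hBdef] at hbase
  have hsplit : (1 + (keyG (zpt I (V - I) (U - 1) W)).im) - (1 + (keyG (zpt I (V₀ - I) (U₀ - 1) 0)).im) =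
      (keyG₁ I * Lpt I (V - I) (U - 1) W + keyG₂ I / 2 * (I - 1) ^ 2 * (W : ℂ) ^ 2).im + R.im - B.im := by
    have e1 : keyG (zpt I (V - I) (U - 1) W) =
        (keyG₁ I * Lpt I (V - I) (U - 1) W + keyG₂ I / 2 * (I - 1) ^ 2 * (W : ℂ) ^ 2) + R + keyG I := by
      rw [hRdef]; ring
    have e2 : keyG (zpt I (V₀ - I) (U₀ - 1) 0) = B + keyG I := by rw [hBdef]; ring
    rw [e1, e2]
    simp only [add_im]
    ring
  have htarget : (W ^ 2 + 2 * W - 8 * t) / (2 * Real.sqrt 2 * π) = a * (W + W ^ 2 / 2 - 4 * t) := by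
    rw [ha]
    have : Real.sqrt 2 ≠ 0 := Real.sqrt_ne_zero'.2 two_pos
    field_simp
    ring
  rw [hsplit, im_main_I, htarget]
  have hcoef : |a * ((V - I).im - (U - 1) + W + W ^ 2 / 2) - a * (W + W ^ 2 / 2 - 4 * t)| ≤
      a * (6 * (K * δ ^ 3)) := by
    rw [← mul_sub, abs_mul, abs_of_nonneg ha0]
    refine mul_le_mul_of_nonneg_left ?_ ha0
    have : (V - I).im - (U - 1) + W + W ^ 2 / 2 - (W + W ^ 2 / 2 - 4 * t) =
        ((V - I).im + 2 * t) - (U - 1 - 2 * t) := by ring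
    rw [this]
    refine (abs_sub _ _).trans ?_
    linarith
  have e : a * ((V - I).im - (U - 1) + W + W ^ 2 / 2) + R.im - B.im - a * (W + W ^ 2 / 2 - 4 * t) =
      (a * ((V - I).im - (U - 1) + W + W ^ 2 / 2) - a * (W + W ^ 2 / 2 - 4 * t)) + R.im + (-B.im) := by
    ring
  rw [show (Real.sqrt 2 * π)⁻¹ = a from rfl, e]
  have hb : |-B.im| ≤ C * δ ^ 3 := by
    rw [abs_neg]
    exact (abs_im_le_norm _).trans hbase
  have hr : |R.im| ≤ C * δ ^ 3 := (abs_im_le_norm _).trans hR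
  calc |a * ((V - I).im - (U - 1) + W + W ^ 2 / 2) - a * (W + W ^ 2 / 2 - 4 * t) + R.im + -B.im|
      ≤ |a * ((V - I).im - (U - 1) + W + W ^ 2 / 2) - a * (W + W ^ 2 / 2 - 4 * t)| + |R.im| +
          |-B.im| := abs_add_three _ _ _
    _ ≤ a * (6 * (K * δ ^ 3)) + C * δ ^ 3 + C * δ ^ 3 := add_le_add (add_le_add hcoef hr) hb
    _ = (a * (6 * K) + C + C) * δ ^ 3 := by ring

/-! ### The computation at the second base point `(1, 2i, 0)` -/

/-- The imaginary part of the main term at `z₀ = 2i`: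
`Im(G'(2i) L + ½ G''(2i) (2i - 1)² w²) = (3 v.im + v.re - 6u + 5w + (15/8) w²)/(10 π)`. [cite: LawlerSchrammWerner2004, Prop. 4.3 (proof)] -/
theorem im_main_two_mul_I (v : ℂ) (u w : ℝ) :
    (keyG₁ (2 * I) * Lpt (2 * I) v u w + keyG₂ (2 * I) / 2 * (2 * I - 1) ^ 2 * (w : ℂ) ^ 2).im =
      π⁻¹ / 10 * (3 * v.im + v.re - 6 * u + 5 * w + 15 / 8 * w ^ 2) := by
  rw [keyG₂_two_mul_I, keyG₁_two_mul_I, Lpt, div_eq_mul_inv _ (2 : ℂ), inv_two_eq_ofReal]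
  simp only [mul_im, mul_re, add_im, add_re, sub_im, sub_re, ofReal_im, ofReal_re, I_im, I_re,
    one_im, one_re, pow_two, neg_im, neg_re]
  norm_num
  ring

/-- **The key Taylor computation at the base point `(U₀, V₀, W₀) = (1 + O(δ³), 2i + O(δ³), 0)`**
([LSW04], proof of Prop. 4.3: "while `V₀ = 2i + O(δ³)` and `U₀ = 1 + O(δ³)` give
`3 E[W_m²] + 8 E[W_m] - 24 E[t_m] = O(δ³)`"): pointwise,
`f(U, V, W) - f(U₀, V₀, 0) = (3W² + 8W - 24t)/(16 π) + O(δ³)`. [cite: LawlerSchrammWerner2004, Prop. 4.3 (proof)] -/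
theorem keyF_taylor_two_mul_I (K : ℝ) (hK : 0 ≤ K) : ∃ δ₀ : ℝ, 0 < δ₀ ∧ ∃ C : ℝ, ∀ δ : ℝ,
    0 < δ → δ ≤ δ₀ → ∀ (U₀ U W t : ℝ) (V₀ V : ℂ), |U₀ - 1| ≤ K * δ ^ 3 →
      ‖V₀ - 2 * I‖ ≤ K * δ ^ 3 → |W| ≤ 2 * δ → 0 ≤ t → t ≤ 2 * δ ^ 2 →
      ‖V - V₀ - 2 * t / V₀‖ ≤ K * δ ^ 3 → |U - U₀ - 2 * t / U₀| ≤ K * δ ^ 3 →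
      |keyF U V W - keyF U₀ V₀ 0 - (3 * W ^ 2 + 8 * W - 24 * t) / (16 * π)| ≤ C * δ ^ 3 := by
  have h2I_im : (2 * I).im = 2 := by simp
  have h2I_norm : ‖2 * I‖ = 2 := by simp
  obtain ⟨C, hC⟩ := keyG_pieces (z₀ := 2 * I) (by rw [h2I_im]; norm_num) (by rw [h2I_norm]) K hK
  set b : ℝ := π⁻¹ / 10 with hb
  have hb0 : 0 ≤ b := by positivity
  refine ⟨1 / (40 * (K + 1)), by positivity, b * (30 * K) + C + C, ?_⟩
  intro δ hδ hδ₀ U₀ U W t V₀ V hU₀ hV₀ hW ht ht2 hV hU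
  obtain ⟨hδ40, hKδ3, hδsq, hU₀n, hV₀n, hu9, hv9, hU₀9⟩ :=
    reduced_bounds hK hδ hδ₀ (by rw [h2I_norm]; norm_num) hU₀ hV₀ ht ht2 hV hU
  obtain ⟨hzim, hz'im, hR, hbase⟩ :=
    hC δ (V - 2 * I) V₀ (U - 1) U₀ W hδ hδ40 hKδ3 hu9 hv9 hW hU₀ hU₀9 hV₀
  -- the `t`-terms
  have hvt := norm_v_sub_le hK hδ.le ht ht2 hδsq hV₀ hV₀n (by rw [h2I_norm]; norm_num) hV
  have hdiv : (2 * t / (2 * I) : ℂ) = -(t * I) := by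
    field_simp
    ring_nf
    rw [I_sq]
    ring
  rw [hdiv] at hvt
  have hEim : |(V - 2 * I).im + t| ≤ 3 * (K * δ ^ 3) := by
    have h2 : (V - 2 * I).im + t = (V - 2 * I - -(t * I)).im := by
      simp [sub_im, mul_im]
    rw [h2]
    exact (abs_im_le_norm _).trans hvt
  have hEre : |(V - 2 * I).re| ≤ 3 * (K * δ ^ 3) := by
    have h2 : (V - 2 * I).re = (V - 2 * I - -(t * I)).re := by
      simp [sub_re, mul_re]
    rw [h2]
    exact (abs_re_le_norm _).trans hvt
  have hEu : |U - 1 - 2 * t| ≤ 3 * (K * δ ^ 3) := abs_u_sub_le hK hδ.le ht ht2 hδsq hU₀ hU₀n hU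
  -- `h = 1 + Im G`, and the split of `G z - G z'`
  rw [keyF_eq_keyH_zpt (2 * I) U V W, keyF_eq_keyH_zpt (2 * I) U₀ V₀ 0, keyH_eq hzim, keyH_eq hz'im]
  obtain ⟨R, hRdef⟩ : ∃ R : ℂ, R = keyG (zpt (2 * I) (V - 2 * I) (U - 1) W) - keyG (2 * I) -
      (keyG₁ (2 * I) * Lpt (2 * I) (V - 2 * I) (U - 1) W +
        keyG₂ (2 * I) / 2 * (2 * I - 1) ^ 2 * (W : ℂ) ^ 2) := ⟨_, rfl⟩
  obtain ⟨B, hBdef⟩ : ∃ B : ℂ, B = keyG (zpt (2 * I) (V₀ - 2 * I) (U₀ - 1) 0) - keyG (2 * I) :=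
    ⟨_, rfl⟩
  rw [← hRdef] at hR
  rw [← hBdef] at hbase
  have hsplit : (1 + (keyG (zpt (2 * I) (V - 2 * I) (U - 1) W)).im) -
      (1 + (keyG (zpt (2 * I) (V₀ - 2 * I) (U₀ - 1) 0)).im) =
      (keyG₁ (2 * I) * Lpt (2 * I) (V - 2 * I) (U - 1) W +
        keyG₂ (2 * I) / 2 * (2 * I - 1) ^ 2 * (W : ℂ) ^ 2).im + R.im - B.im := by
    have e1 : keyG (zpt (2 * I) (V - 2 * I) (U - 1) W) =
        (keyG₁ (2 * I) * Lpt (2 * I) (V - 2 * I) (U - 1) W +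
          keyG₂ (2 * I) / 2 * (2 * I - 1) ^ 2 * (W : ℂ) ^ 2) + R + keyG (2 * I) := by
      rw [hRdef]; ring
    have e2 : keyG (zpt (2 * I) (V₀ - 2 * I) (U₀ - 1) 0) = B + keyG (2 * I) := by rw [hBdef]; ring
    rw [e1, e2]
    simp only [add_im]
    ring
  have htarget : (3 * W ^ 2 + 8 * W - 24 * t) / (16 * π) = b * (5 * W + 15 / 8 * W ^ 2 - 15 * t) := by
    rw [hb]
    field_simp
    ring
  rw [hsplit, im_main_two_mul_I, htarget]
  have hcoef : |b * (3 * (V - 2 * I).im + (V - 2 * I).re - 6 * (U - 1) + 5 * W + 15 / 8 * W ^ 2) -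
      b * (5 * W + 15 / 8 * W ^ 2 - 15 * t)| ≤ b * (30 * (K * δ ^ 3)) := by
    rw [← mul_sub, abs_mul, abs_of_nonneg hb0]
    refine mul_le_mul_of_nonneg_left ?_ hb0
    have : 3 * (V - 2 * I).im + (V - 2 * I).re - 6 * (U - 1) + 5 * W + 15 / 8 * W ^ 2 -
        (5 * W + 15 / 8 * W ^ 2 - 15 * t) =
        3 * ((V - 2 * I).im + t) + (V - 2 * I).re - 6 * (U - 1 - 2 * t) := by ring
    rw [this]
    refine (abs_sub _ _).trans ((add_le_add ((abs_add_le _ _).trans (add_le_add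
      (by rw [abs_mul, abs_of_pos (by norm_num : (0 : ℝ) < 3)]) hEre)) le_rfl).trans ?_)
    rw [abs_mul, abs_of_pos (by norm_num : (0 : ℝ) < 6)]
    linarith
  have e : b * (3 * (V - 2 * I).im + (V - 2 * I).re - 6 * (U - 1) + 5 * W + 15 / 8 * W ^ 2) +
      R.im - B.im - b * (5 * W + 15 / 8 * W ^ 2 - 15 * t) =
      (b * (3 * (V - 2 * I).im + (V - 2 * I).re - 6 * (U - 1) + 5 * W + 15 / 8 * W ^ 2) -
        b * (5 * W + 15 / 8 * W ^ 2 - 15 * t)) + R.im + -B.im := by ring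
  rw [show π⁻¹ / 10 = b from rfl, e]
  have hb' : |-B.im| ≤ C * δ ^ 3 := by
    rw [abs_neg]
    exact (abs_im_le_norm _).trans hbase
  have hr : |R.im| ≤ C * δ ^ 3 := (abs_im_le_norm _).trans hR
  calc |b * (3 * (V - 2 * I).im + (V - 2 * I).re - 6 * (U - 1) + 5 * W + 15 / 8 * W ^ 2) -
        b * (5 * W + 15 / 8 * W ^ 2 - 15 * t) + R.im + -B.im|
      ≤ |b * (3 * (V - 2 * I).im + (V - 2 * I).re - 6 * (U - 1) + 5 * W + 15 / 8 * W ^ 2) -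
          b * (5 * W + 15 / 8 * W ^ 2 - 15 * t)| + |R.im| + |-B.im| := abs_add_three _ _ _
    _ ≤ b * (30 * (K * δ ^ 3)) + C * δ ^ 3 + C * δ ^ 3 := add_le_add (add_le_add hcoef hr) hb'
    _ = (b * (30 * K) + C + C) * δ ^ 3 := by ring

/-! ### Solving the two relations -/

/-- **From the two relations to the key estimate** ([LSW04], end of the proof of Prop. 4.3:
"Combining these two relations together implies (4.7) and (4.8)"): if
`|A + 2B - 8C| ≤ ε` and `|3A + 8B - 24C| ≤ ε` then `|B| ≤ 2ε` and `|A - 8C| ≤ 5ε`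
(`B = E[W_m]`, `A = E[W_m²]`, `C = E[t_m]`). [cite: LawlerSchrammWerner2004, Prop. 4.3 (proof)] -/
theorem key_relations {A B C ε : ℝ} (h₁ : |A + 2 * B - 8 * C| ≤ ε) (h₂ : |3 * A + 8 * B - 24 * C| ≤ ε) :
    |B| ≤ 2 * ε ∧ |A - 8 * C| ≤ 5 * ε := by
  have e1 : B = ((3 * A + 8 * B - 24 * C) - 3 * (A + 2 * B - 8 * C)) / 2 := by ring
  have e2 : A - 8 * C = 4 * (A + 2 * B - 8 * C) - (3 * A + 8 * B - 24 * C) := by ring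
  rw [abs_le] at h₁ h₂ ⊢
  rw [abs_le]
  constructor
  · constructor <;> [rw [e1]; rw [e1]] <;> linarith [h₁.1, h₁.2, h₂.1, h₂.2]
  · constructor <;> linarith [h₁.1, h₁.2, h₂.1, h₂.2]

/-! ### `h` is harmonic on `ℍ` with boundary values `0` on `(0, 1)`, `1` on `(1, ∞)` -/

open InnerProductSpace in
/-- **`h` is harmonic in `ℍ`** ([LSW04], proof of Prop. 4.3: "Note that `h` is harmonic in `ℍ`"): it is
`1 + Im G` with `G` holomorphic. [cite: LawlerSchrammWerner2004, Prop. 4.3 (proof)] -/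
theorem harmonicOnNhd_keyH : HarmonicOnNhd keyH {z : ℂ | 0 < z.im} := by
  intro z hz
  have hA : AnalyticAt ℂ keyG z := differentiableOn_keyG.analyticAt (UpperHalfPlane.isOpen_upperHalfPlaneSet.mem_nhds hz)
  have h1 : HarmonicAt (fun w ↦ (fun _ : ℂ ↦ (1 : ℝ)) w + (fun w ↦ (keyG w).im) w) z :=
    (harmonicAt_const (1 : ℝ)).add hA.harmonicAt_im
  refine (harmonicAt_congr_nhds ?_).2 h1
  filter_upwards [UpperHalfPlane.isOpen_upperHalfPlaneSet.mem_nhds hz] with w hw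
  exact keyH_eq hw

/-- `√x` is real for `x > 0`: `Im √x = 0`, and `√` is continuous there. [folklore] -/
theorem csqrt_ofReal_im {x : ℝ} (hx : 0 ≤ x) : (csqrt x).im = 0 := by
  rw [csqrt, inv_two_eq_ofReal, ← ofReal_cpow hx, ofReal_im]

/-- `√` is continuous off the branch cut. [folklore] -/
theorem continuousAt_csqrt {z : ℂ} (hz : z ∈ slitPlane) : ContinuousAt csqrt z :=
  (Complex.hasStrictDerivAt_cpow_const (c := (2⁻¹ : ℂ)) hz).hasDerivAt.continuousAt

/-- The argument of LSW's `cot⁻¹`, `(1 - |z|)/(2 Im √z)`, tends to `+∞` at points of `(0, 1)`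
and to `-∞` at points of `(1, ∞)` (from within `ℍ`). [cite: LawlerSchrammWerner2004, Prop. 4.3 (proof)] -/
theorem tendsto_ratio_atTop {x : ℝ} (hx0 : 0 < x) (hx1 : x < 1) :
    Tendsto (fun z : ℂ ↦ (1 - ‖z‖) / (2 * (csqrt z).im)) (𝓝[{z : ℂ | 0 < z.im}] x) atTop := by
  have hsl : (x : ℂ) ∈ slitPlane := mem_slitPlane_iff.2 (Or.inl (by simpa using hx0))
  have h1 : Tendsto (fun z : ℂ ↦ 1 - ‖z‖) (𝓝[{z : ℂ | 0 < z.im}] x) (𝓝 (1 - x)) := by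
    have : Tendsto (fun z : ℂ ↦ 1 - ‖z‖) (𝓝 (x : ℂ)) (𝓝 (1 - ‖(x : ℂ)‖)) :=
      (continuous_const.sub continuous_norm).continuousAt
    rw [Complex.norm_real, Real.norm_eq_abs, abs_of_pos hx0] at this
    exact this.mono_left nhdsWithin_le_nhds
  have h2 : Tendsto (fun z : ℂ ↦ 2 * (csqrt z).im) (𝓝[{z : ℂ | 0 < z.im}] x) (𝓝[>] 0) := by
    rw [tendsto_nhdsWithin_iff]
    constructor
    · have : Tendsto (fun z : ℂ ↦ 2 * (csqrt z).im) (𝓝 (x : ℂ)) (𝓝 (2 * (csqrt x).im)) :=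
        ((Complex.continuous_im.continuousAt.comp (continuousAt_csqrt hsl)).const_mul 2)
      rw [csqrt_ofReal_im hx0.le, mul_zero] at this
      exact this.mono_left nhdsWithin_le_nhds
    · filter_upwards [self_mem_nhdsWithin] with z hz
      exact mul_pos two_pos (csqrt_im_pos hz)
  have h3 := h1.pos_mul_atTop (by linarith) (tendsto_inv_nhdsGT_zero.comp h2)
  simpa [div_eq_mul_inv] using h3

/-- The argument of LSW's `cot⁻¹` tends to `-∞` at points of `(1, ∞)` (from within `ℍ`). [folklore] -/
theorem tendsto_ratio_atBot {x : ℝ} (hx1 : 1 < x) :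
    Tendsto (fun z : ℂ ↦ (1 - ‖z‖) / (2 * (csqrt z).im)) (𝓝[{z : ℂ | 0 < z.im}] x) atBot := by
  have hx0 : 0 < x := by linarith
  have hsl : (x : ℂ) ∈ slitPlane := mem_slitPlane_iff.2 (Or.inl (by simpa using hx0))
  have h1 : Tendsto (fun z : ℂ ↦ 1 - ‖z‖) (𝓝[{z : ℂ | 0 < z.im}] x) (𝓝 (1 - x)) := by
    have : Tendsto (fun z : ℂ ↦ 1 - ‖z‖) (𝓝 (x : ℂ)) (𝓝 (1 - ‖(x : ℂ)‖)) :=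
      (continuous_const.sub continuous_norm).continuousAt
    rw [Complex.norm_real, Real.norm_eq_abs, abs_of_pos hx0] at this
    exact this.mono_left nhdsWithin_le_nhds
  have h2 : Tendsto (fun z : ℂ ↦ 2 * (csqrt z).im) (𝓝[{z : ℂ | 0 < z.im}] x) (𝓝[>] 0) := by
    rw [tendsto_nhdsWithin_iff]
    constructor
    · have : Tendsto (fun z : ℂ ↦ 2 * (csqrt z).im) (𝓝 (x : ℂ)) (𝓝 (2 * (csqrt x).im)) :=
        ((Complex.continuous_im.continuousAt.comp (continuousAt_csqrt hsl)).const_mul 2)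
      rw [csqrt_ofReal_im hx0.le, mul_zero] at this
      exact this.mono_left nhdsWithin_le_nhds
    · filter_upwards [self_mem_nhdsWithin] with z hz
      exact mul_pos two_pos (csqrt_im_pos hz)
  have h3 := h1.neg_mul_atTop (by linarith) (tendsto_inv_nhdsGT_zero.comp h2)
  simpa [div_eq_mul_inv] using h3

/-- **`h = 0` on `(0, 1)`** ([LSW04], proof of Prop. 4.3: "`h` … is equal to `0` on `(0, 1)`"), as a
boundary limit from `ℍ`. [cite: LawlerSchrammWerner2004, Prop. 4.3 (proof)] -/
theorem tendsto_keyH_zero {x : ℝ} (hx0 : 0 < x) (hx1 : x < 1) :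
    Tendsto keyH (𝓝[{z : ℂ | 0 < z.im}] x) (𝓝 0) := by
  have h := (Real.tendsto_arctan_atTop.mono_right nhdsWithin_le_nhds).comp
    (tendsto_ratio_atTop hx0 hx1)
  have h2 := (h.const_sub (π / 2)).const_mul π⁻¹
  rw [sub_self, mul_zero] at h2
  exact h2

/-- **`h = 1` on `(1, ∞)`** ([LSW04], proof of Prop. 4.3: "`h` … is equal to `1` on `(1, ∞)`"), as a
boundary limit from `ℍ`. [cite: LawlerSchrammWerner2004, Prop. 4.3 (proof)] -/
theorem tendsto_keyH_one {x : ℝ} (hx1 : 1 < x) :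
    Tendsto keyH (𝓝[{z : ℂ | 0 < z.im}] x) (𝓝 1) := by
  have h := (Real.tendsto_arctan_atBot.mono_right nhdsWithin_le_nhds).comp (tendsto_ratio_atBot hx1)
  have h2 := (h.const_sub (π / 2)).const_mul π⁻¹
  have hπ : (π : ℝ) ≠ 0 := Real.pi_ne_zero
  rw [show π⁻¹ * (π / 2 - -(π / 2)) = 1 by field_simp; ring] at h2
  exact h2

/-- **The Neumann condition on `(-∞, 0)`** ([LSW04], proof of Prop. 4.3: "`∂_y h = 0` on `(-∞, 0)`"): in
`ℍ`, `∂_y h = ∂_y Im G = Re G'` with `G' = keyG₁`; on the negative axis the explicit formula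
`G'(x) = 1/(π √x (1 - x))` with `√x = i √|x|` is purely imaginary. [cite: LawlerSchrammWerner2004, Prop. 4.3 (proof)] -/
theorem keyG₁_re_of_neg {x : ℝ} (hx : x < 0) : (keyG₁ x).re = 0 := by
  have hsq : csqrt x = (Real.sqrt (-x) : ℂ) * I := by
    have hsqrt : (-x) ^ (2⁻¹ : ℝ) = Real.sqrt (-x) := by
      rw [Real.sqrt_eq_rpow]
      norm_num
    rw [csqrt, ofReal_cpow_of_nonpos hx.le, inv_two_eq_ofReal, ← ofReal_neg,
      ← ofReal_cpow (by linarith) (2⁻¹ : ℝ), hsqrt]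
    congr 1
    rw [show (π : ℂ) * I * ((2⁻¹ : ℝ) : ℂ) = ((π / 2 : ℝ) : ℂ) * I by push_cast; ring, exp_mul_I,
      ← ofReal_cos, ← ofReal_sin, Real.cos_pi_div_two, Real.sin_pi_div_two]
    simp
  rw [keyG₁, hsq]
  have h1 : (π : ℂ)⁻¹ / ((Real.sqrt (-x) : ℂ) * I * (1 - x)) =
      ((-(π⁻¹ / (Real.sqrt (-x) * (1 - x))) : ℝ) : ℂ) * I := by
    have hs : (Real.sqrt (-x) : ℂ) ≠ 0 := ofReal_ne_zero.2 (Real.sqrt_ne_zero'.2 (by linarith))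
    have h1x : (1 - (x : ℂ)) ≠ 0 := by
      rw [show (1 - (x : ℂ)) = ((1 - x : ℝ) : ℂ) by push_cast; ring]
      exact ofReal_ne_zero.2 (by linarith)
    have hπ := pi_ne_zero'
    push_cast
    field_simp
    ring_nf
    rw [I_sq]
    ring
  rw [h1, mul_I_re, ofReal_im, neg_zero]

/-! ### Assembly: Prop. 4.3 for `k = 0` from (4.9), (4.11), (4.12) -/

/-- `0 ≤ h ≤ 1` everywhere (`cot⁻¹ ∈ (0, π)`). [cite: LawlerSchrammWerner2004, Prop. 4.3 (proof)] -/
theorem keyH_mem_Icc (z : ℂ) : keyH z ∈ Icc (0 : ℝ) 1 := by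
  rw [keyH]
  have h := Real.arctan_mem_Ioo ((1 - ‖z‖) / (2 * (csqrt z).im))
  have hπ : 0 < π := Real.pi_pos
  constructor
  · exact mul_nonneg (inv_nonneg.2 hπ.le) (by linarith [h.2])
  · calc π⁻¹ * (π / 2 - Real.arctan ((1 - ‖z‖) / (2 * (csqrt z).im))) ≤ π⁻¹ * π :=
          mul_le_mul_of_nonneg_left (by linarith [h.1]) (inv_nonneg.2 hπ.le)
      _ = 1 := inv_mul_cancel₀ hπ.ne'

/-- `|f| ≤ 1`. [cite: LawlerSchrammWerner2004, Prop. 4.3 (proof)] -/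
theorem abs_keyF_le (U : ℝ) (V : ℂ) (W : ℝ) : |keyF U V W| ≤ 1 := by
  rw [keyF]
  have h := keyH_mem_Icc ((V - W) / (U - W))
  rw [abs_le]
  exact ⟨by linarith [h.1], h.2⟩

/-- A random variable within `Kδ³` of a value of `f` is bounded, hence integrable. [folklore] -/
theorem integrable_of_near_keyF {Ω : Type*} [MeasurableSpace Ω] {P : Measure Ω} [IsFiniteMeasure P]
    {q U W : Ω → ℝ} {V : Ω → ℂ} {e : ℝ} (hqm : AEStronglyMeasurable q P)
    (hq : ∀ ω, |q ω - keyF (U ω) (V ω) (W ω)| ≤ e) : Integrable q P := by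
  refine Integrable.of_bound hqm (e + 1) (ae_of_all _ fun ω ↦ ?_)
  rw [Real.norm_eq_abs]
  have h3 : |q ω| ≤ |q ω - keyF (U ω) (V ω) (W ω)| + |keyF (U ω) (V ω) (W ω)| := by
    have := abs_add_le (q ω - keyF (U ω) (V ω) (W ω)) (keyF (U ω) (V ω) (W ω))
    rwa [sub_add_cancel] at this
  linarith [hq ω, abs_keyF_le (U ω) (V ω) (W ω)]

/-- Integrating a pointwise `O(δ³)` identity: if `|X ω / c - (q ω - p)| ≤ e` for all `ω`, `E[q] = p`
and `X`, `q` are integrable on a probability space, then `|E[X]| ≤ |c| e`. [folklore] -/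
theorem abs_integral_le_of_pointwise {Ω : Type*} [MeasurableSpace Ω] {P : Measure Ω}
    [IsProbabilityMeasure P] {X q : Ω → ℝ} {c p e : ℝ} (hc : c ≠ 0) (hXi : Integrable X P)
    (hqi : Integrable q P) (hqint : ∫ ω, q ω ∂P = p) (h : ∀ ω, |X ω / c - (q ω - p)| ≤ e) :
    |∫ ω, X ω ∂P| ≤ |c| * e := by
  have hqp : Integrable (fun ω ↦ q ω - p) P := hqi.sub (integrable_const p)
  have h2 : ∫ ω, (q ω - p) ∂P = 0 := by
    have h := integral_sub hqi (integrable_const p)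
    simp only [integral_const, probReal_univ, smul_eq_mul, one_mul, hqint, sub_self] at h
    exact h
  have hint : ∫ ω, (X ω / c - (q ω - p)) ∂P = (∫ ω, X ω ∂P) / c := by
    rw [integral_sub (hXi.div_const c) hqp, h2, sub_zero, integral_div]
  have hb := norm_integral_le_of_norm_le_const (μ := P) (f := fun ω ↦ X ω / c - (q ω - p))
    (C := e) (ae_of_all _ fun ω ↦ by rw [Real.norm_eq_abs]; exact h ω)
  rw [hint, Real.norm_eq_abs, probReal_univ, mul_one, abs_div,
    div_le_iff₀ (abs_pos.2 hc)] at hb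
  linarith [mul_comm e |c|]

/-- **[LSW04] Prop. 4.3 (`k = 0`) from the estimates (4.9), (4.11), (4.12) of its proof.** On a
probability space carrying `W = W_m`, `t = t_m` (with `|W_m| ≤ 2δ`, `0 ≤ t_m ≤ 2δ²`) and the
Loewner images `U_m, V_m` of `u₀, v₀` (resp. `U_m', V_m'` for the second vertex `v₀'`), suppose:
(4.11) `|V_m - V₀ - 2t_m/V₀| ≤ Kδ³`, `|U_m - U₀ - 2t_m/U₀| ≤ Kδ³` with `V₀ = i + O(δ³)`,
`U₀ = 1 + O(δ³)`, and the same at the second base point `V₀' = 2i + O(δ³)`, `U₀' = 1 + O(δ³)`;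
(4.9) `P[A] = f(U₀, V₀, 0) + O(δ³)` (a number `p`); (4.12) `P[A | D_m] = f(U_m, V_m, W_m) + O(δ³)`
(a random variable `q` with `E[q] = P[A] = p`, the identity (4.10) `P[A] = E[P[A | D_m]]`), and
likewise `p', q'` for the event `A'` of the second vertex. Then **`|E[W_m]| ≤ Cδ³` and
`|E[W_m²] - 8 E[t_m]| ≤ Cδ³`** — the printed conclusions (4.7), (4.8) for `k = 0` — by
integrating `keyF_taylor_I` / `keyF_taylor_two_mul_I` and `key_relations`.
[cite: LawlerSchrammWerner2004, Prop. 4.3] -/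
theorem prop43_of_estimates (K : ℝ) (hK : 0 ≤ K) : ∃ δ₀ : ℝ, 0 < δ₀ ∧ ∃ C : ℝ, ∀ δ : ℝ,
    0 < δ → δ ≤ δ₀ → ∀ {Ω : Type*} [MeasurableSpace Ω] (P : Measure Ω) [IsProbabilityMeasure P]
      (W t U U' q q' : Ω → ℝ) (V V' : Ω → ℂ) (U₀ U₀' p p' : ℝ) (V₀ V₀' : ℂ),
      AEStronglyMeasurable W P → AEStronglyMeasurable t P →
      AEStronglyMeasurable q P → AEStronglyMeasurable q' P →
      (∀ ω, |W ω| ≤ 2 * δ) → (∀ ω, 0 ≤ t ω ∧ t ω ≤ 2 * δ ^ 2) →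
      |U₀ - 1| ≤ K * δ ^ 3 → ‖V₀ - I‖ ≤ K * δ ^ 3 →
      (∀ ω, ‖V ω - V₀ - 2 * t ω / V₀‖ ≤ K * δ ^ 3) →
      (∀ ω, |U ω - U₀ - 2 * t ω / U₀| ≤ K * δ ^ 3) →
      |U₀' - 1| ≤ K * δ ^ 3 → ‖V₀' - 2 * I‖ ≤ K * δ ^ 3 →
      (∀ ω, ‖V' ω - V₀' - 2 * t ω / V₀'‖ ≤ K * δ ^ 3) →
      (∀ ω, |U' ω - U₀' - 2 * t ω / U₀'| ≤ K * δ ^ 3) →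
      |p - keyF U₀ V₀ 0| ≤ K * δ ^ 3 → (∀ ω, |q ω - keyF (U ω) (V ω) (W ω)| ≤ K * δ ^ 3) →
      ∫ ω, q ω ∂P = p →
      |p' - keyF U₀' V₀' 0| ≤ K * δ ^ 3 → (∀ ω, |q' ω - keyF (U' ω) (V' ω) (W ω)| ≤ K * δ ^ 3) →
      ∫ ω, q' ω ∂P = p' →
      |∫ ω, W ω ∂P| ≤ C * δ ^ 3 ∧ |∫ ω, W ω ^ 2 ∂P - 8 * ∫ ω, t ω ∂P| ≤ C * δ ^ 3 := by
  obtain ⟨δ₁, hδ₁, C₁, h₁⟩ := keyF_taylor_I K hK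
  obtain ⟨δ₂, hδ₂, C₂, h₂⟩ := keyF_taylor_two_mul_I K hK
  refine ⟨min δ₁ δ₂, lt_min hδ₁ hδ₂,
    5 * (|2 * Real.sqrt 2 * π| * (|C₁| + 2 * K) + |16 * π| * (|C₂| + 2 * K)), ?_⟩
  intro δ hδ hδ₀ Ω _ P _ W t U U' q q' V V' U₀ U₀' p p' V₀ V₀' hWm htm hqm hq'm hW ht hU₀ hV₀ hV hU
    hU₀' hV₀' hV' hU' hp hq hqint hp' hq' hq'int
  have hδ3 : 0 ≤ δ ^ 3 := pow_nonneg hδ.le 3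
  -- pointwise expansions
  have e₁ : ∀ ω, |keyF (U ω) (V ω) (W ω) - keyF U₀ V₀ 0 -
      (W ω ^ 2 + 2 * W ω - 8 * t ω) / (2 * Real.sqrt 2 * π)| ≤ C₁ * δ ^ 3 := fun ω ↦
    h₁ δ hδ (hδ₀.trans (min_le_left _ _)) U₀ (U ω) (W ω) (t ω) V₀ (V ω) hU₀ hV₀ (hW ω) (ht ω).1
      (ht ω).2 (hV ω) (hU ω)
  have e₂ : ∀ ω, |keyF (U' ω) (V' ω) (W ω) - keyF U₀' V₀' 0 -
      (3 * W ω ^ 2 + 8 * W ω - 24 * t ω) / (16 * π)| ≤ C₂ * δ ^ 3 := fun ω ↦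
    h₂ δ hδ (hδ₀.trans (min_le_right _ _)) U₀' (U' ω) (W ω) (t ω) V₀' (V' ω) hU₀' hV₀' (hW ω)
      (ht ω).1 (ht ω).2 (hV' ω) (hU' ω)
  -- integrability
  have hWi : Integrable W P := Integrable.of_bound hWm (2 * δ) (ae_of_all _ fun ω ↦ by
    rw [Real.norm_eq_abs]; exact hW ω)
  have hW2i : Integrable (fun ω ↦ W ω ^ 2) P := Integrable.of_bound (hWm.pow 2) ((2 * δ) ^ 2)
    (ae_of_all _ fun ω ↦ by
      rw [Real.norm_eq_abs, abs_pow]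
      exact pow_le_pow_left₀ (abs_nonneg _) (hW ω) 2)
  have hti : Integrable t P := Integrable.of_bound htm (2 * δ ^ 2) (ae_of_all _ fun ω ↦ by
    rw [Real.norm_eq_abs, abs_of_nonneg (ht ω).1]; exact (ht ω).2)
  have hqi : Integrable q P := integrable_of_near_keyF hqm hq
  have hq'i : Integrable q' P := integrable_of_near_keyF hq'm hq'
  -- the two relations, integrated
  have hX : |∫ ω, (W ω ^ 2 + 2 * W ω - 8 * t ω) ∂P| ≤
      |2 * Real.sqrt 2 * π| * ((|C₁| + 2 * K) * δ ^ 3) := by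
    refine abs_integral_le_of_pointwise (by positivity) ((hW2i.add (hWi.const_mul 2)).sub
      (hti.const_mul 8)) hqi hqint fun ω ↦ ?_
    have : (W ω ^ 2 + 2 * W ω - 8 * t ω) / (2 * Real.sqrt 2 * π) - (q ω - p) =
        -(keyF (U ω) (V ω) (W ω) - keyF U₀ V₀ 0 -
          (W ω ^ 2 + 2 * W ω - 8 * t ω) / (2 * Real.sqrt 2 * π)) -
        (q ω - keyF (U ω) (V ω) (W ω)) + (p - keyF U₀ V₀ 0) := by ring
    rw [this]
    have g1 : |-(keyF (U ω) (V ω) (W ω) - keyF U₀ V₀ 0 -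
        (W ω ^ 2 + 2 * W ω - 8 * t ω) / (2 * Real.sqrt 2 * π))| ≤ C₁ * δ ^ 3 := by
      rw [abs_neg]; exact e₁ ω
    have g2 := (abs_add_le _ _).trans (add_le_add ((abs_sub _ _).trans (add_le_add g1 (hq ω))) hp)
    refine g2.trans ?_
    nlinarith [mul_le_mul_of_nonneg_right (le_abs_self C₁) hδ3]
  have hY : |∫ ω, (3 * W ω ^ 2 + 8 * W ω - 24 * t ω) ∂P| ≤
      |16 * π| * ((|C₂| + 2 * K) * δ ^ 3) := by
    refine abs_integral_le_of_pointwise (by positivity) (((hW2i.const_mul 3).add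
      (hWi.const_mul 8)).sub (hti.const_mul 24)) hq'i hq'int fun ω ↦ ?_
    have : (3 * W ω ^ 2 + 8 * W ω - 24 * t ω) / (16 * π) - (q' ω - p') =
        -(keyF (U' ω) (V' ω) (W ω) - keyF U₀' V₀' 0 -
          (3 * W ω ^ 2 + 8 * W ω - 24 * t ω) / (16 * π)) -
        (q' ω - keyF (U' ω) (V' ω) (W ω)) + (p' - keyF U₀' V₀' 0) := by ring
    rw [this]
    have g1 : |-(keyF (U' ω) (V' ω) (W ω) - keyF U₀' V₀' 0 -
        (3 * W ω ^ 2 + 8 * W ω - 24 * t ω) / (16 * π))| ≤ C₂ * δ ^ 3 := by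
      rw [abs_neg]; exact e₂ ω
    have g2 := (abs_add_le _ _).trans (add_le_add ((abs_sub _ _).trans (add_le_add g1 (hq' ω))) hp')
    refine g2.trans ?_
    nlinarith [mul_le_mul_of_nonneg_right (le_abs_self C₂) hδ3]
  -- linearity of the integral
  have hW2' : Integrable (fun ω ↦ 2 * W ω) P := hWi.const_mul 2
  have ht8 : Integrable (fun ω ↦ 8 * t ω) P := hti.const_mul 8
  have i1 : Integrable (fun ω ↦ W ω ^ 2 + 2 * W ω) P := hW2i.add hW2'
  have hXeq : ∫ ω, (W ω ^ 2 + 2 * W ω - 8 * t ω) ∂P =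
      (∫ ω, W ω ^ 2 ∂P) + 2 * (∫ ω, W ω ∂P) - 8 * (∫ ω, t ω ∂P) := by
    rw [integral_sub i1 ht8, integral_add hW2i hW2', integral_const_mul, integral_const_mul]
  have hW3 : Integrable (fun ω ↦ 3 * W ω ^ 2) P := hW2i.const_mul 3
  have hW8 : Integrable (fun ω ↦ 8 * W ω) P := hWi.const_mul 8
  have ht24 : Integrable (fun ω ↦ 24 * t ω) P := hti.const_mul 24
  have i2 : Integrable (fun ω ↦ 3 * W ω ^ 2 + 8 * W ω) P := hW3.add hW8
  have hYeq : ∫ ω, (3 * W ω ^ 2 + 8 * W ω - 24 * t ω) ∂P =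
      3 * (∫ ω, W ω ^ 2 ∂P) + 8 * (∫ ω, W ω ∂P) - 24 * (∫ ω, t ω ∂P) := by
    rw [integral_sub i2 ht24, integral_add hW3 hW8, integral_const_mul, integral_const_mul,
      integral_const_mul]
  rw [hXeq] at hX
  rw [hYeq] at hY
  set ε : ℝ := (|2 * Real.sqrt 2 * π| * (|C₁| + 2 * K) + |16 * π| * (|C₂| + 2 * K)) * δ ^ 3 with hε
  have hεeq : ε = |2 * Real.sqrt 2 * π| * ((|C₁| + 2 * K) * δ ^ 3) +
      |16 * π| * ((|C₂| + 2 * K) * δ ^ 3) := by rw [hε]; ring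
  have h01 : 0 ≤ |2 * Real.sqrt 2 * π| * ((|C₁| + 2 * K) * δ ^ 3) := by positivity
  have h02 : 0 ≤ |16 * π| * ((|C₂| + 2 * K) * δ ^ 3) := by positivity
  have hX' : |(∫ ω, W ω ^ 2 ∂P) + 2 * (∫ ω, W ω ∂P) - 8 * (∫ ω, t ω ∂P)| ≤ ε :=
    hX.trans (by rw [hεeq]; linarith)
  have hY' : |3 * (∫ ω, W ω ^ 2 ∂P) + 8 * (∫ ω, W ω ∂P) - 24 * (∫ ω, t ω ∂P)| ≤ ε :=
    hY.trans (by rw [hεeq]; linarith)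
  obtain ⟨hBle, hAle⟩ := key_relations hX' hY'
  have hε0 : 0 ≤ ε := by rw [hεeq]; linarith
  have hCε : 5 * (|2 * Real.sqrt 2 * π| * (|C₁| + 2 * K) + |16 * π| * (|C₂| + 2 * K)) * δ ^ 3 =
      5 * ε := by rw [hε]; ring
  rw [hCε]
  exact ⟨hBle.trans (by linarith), hAle⟩

end KeyEstimate

end USTPeano

end Literature.Probability.RandomPlanarGeometry
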